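import Literature.Analysis.FluidPDE.NovackLongitudinalBalance
import Literature.Analysis.FluidPDE.NovackMatrixKernel
import Literature.Analysis.FluidPDE.NovackKernelAverages
import HarnessLib

/-!
# The limit `γ → 0` in Novack's combined scale balance: the left-hand side (Novack 2024, §2 Step 2)

Topic: Analysis/FluidPDE, proofs towards the named fact `Torus.novack2024_longAvg_balance`
(`Literature.Analysis.FluidPDE.NovackLongitudinalBalance`). M. Novack, *Scaling laws and exact
results in turbulence*, Nonlinearity 37 (2024) 095002, §2: Step 1 passes "to the limit in every
term from (last:one) except the very last term … using the integrability assumptions on all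
involved quantities and the dominated convergence theorem"; Step 2 does the same for
(last:one:L) and justifies the kernel `ζ_{ℓ,γ}` by "an application of the dominated convergence
theorem". For the smooth combined kernels `M_{ℓ,γ}` (`Torus.novackKernel`,
`Literature.Analysis.FluidPDE.NovackKernelFamily`) this is the convergence, as `γ → 0⁺`, of the
tested balance `𝒩_{M_{ℓ,γ}}(ψ)` (`Torus.matPairing`, `NovackMatrixKernel`) to Novack's scale-`ℓ`
longitudinal pairing `𝒩^L_ℓ(ψ)` (`Torus.novackLongPairing`), built on the sharp kernel
`M_ℓ = |B_ℓ|⁻¹1_{B_ℓ}[(1 − |y|²/ℓ²) 1 + ℓ⁻² y ⊗ y]` ((you:ell:ell)) and its potential.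

## Contents (all proved)

* `Torus.novackKernelE₀`, `Torus.novackPotentialE₀`: the sharp kernel entries
  `|B_ℓ|⁻¹1_{B_ℓ}[(1 − |ξ|²/ℓ²)δᵢⱼ + ℓ⁻²ξᵢξⱼ] = c_ℓ 1_{B_ℓ}[(ℓ² − |ξ|²)δᵢⱼ + ξᵢξⱼ]` and the sharp
  potential `c_ℓ 1_{B_ℓ}[|ξ|² − ((d−3)/2)(ℓ² − |ξ|²)]` (the `γ = 0` members of `novackKernelE`,
  `novackPotentialE`);
* uniform bounds, pointwise convergence (`tendsto_novackKernelE`, `tendsto_novackPotentialE`: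
  `χ_{ℓ,γ}(s) = 1` eventually and `|P_{ℓ,γ}(s) − (ℓ² − s)| ≤ ℓ²γ` for `s < ℓ²`) and the `L¹(ℝ^d)`
  convergence `∫|M_{ℓ,γ}^{ij} − M_ℓ^{ij}| → 0`, `∫|ζ̃_{ℓ,γ} − ζ̃_ℓ| → 0`
  (`tendsto_lintegral_novackKernelE_sub`, `tendsto_lintegral_novackPotentialE_sub`, dominated
  convergence);
* identification of the sharp kernel averages with the objects of `NovackLongitudinalBalance`:
  `longAvg`, `longAvgSq`, `longAvgCube`, `longAvgPressure` (`apply_longAvg_eq_sum_integral`, …);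
* `Torus.tendsto_matPairing_novackKernel_of_test`: `𝒩_{M_{ℓ,γ}}(ψ) → 𝒩^L_ℓ(ψ)` as `γ → 0⁺`
  for `u ∈ L³`, `p ∈ L^{3/2}` jointly measurable and a test function `ψ` supported in `(0,T)` — the
  six pairings through the master limit lemmas of `NovackKernelAverages`.

## References

* M. Novack, *Scaling laws and exact results in turbulence*, Nonlinearity 37 (2024) 095002,
  arXiv:2310.01375, §2 Step 1 ("pass to the limit … dominated convergence theorem"), Step 2
  ((last:one:L), (you:ell:ell), "this choice may be justified by an application of the dominated
  convergence theorem"). [Novack2024]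
-/

noncomputable section

open MeasureTheory MeasureTheory.Measure TopologicalSpace Set Function Filter Metric
open _root_.Topology
open scoped ENNReal NNReal Convolution InnerProductSpace RealInnerProductSpace

namespace Literature.Analysis.FluidPDE.Torus

variable {d : Type*} [Fintype d] [DecidableEq d]

/-! ## The sharp kernels and the convergence `M_{ℓ,γ} → M_ℓ`, `ζ̃_{ℓ,γ} → ζ̃_ℓ` -/

section SharpKernel

variable {ℓ γ : ℝ}

/-- **The sharp combined kernel of Novack's (you:ell:ell)**, entry `(i,j)`, on `ℝ^d`:
`M_ℓ^{ij}(ξ) = |B_ℓ|⁻¹ 1_{B_ℓ}(ξ)[(1 − |ξ|²/ℓ²)δᵢⱼ + ℓ⁻²ξᵢξⱼ] = c_ℓ 1_{B_ℓ}(ξ)[(ℓ² − |ξ|²)δᵢⱼ + ξᵢξⱼ]`,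
the `γ = 0` member of `novackKernelE ℓ γ i j`. [cite: Novack2024, Sect. 2 Step 2 (you:ell:ell)] -/
def novackKernelE₀ (ℓ : ℝ) (i j : d) : EuclideanSpace ℝ d → ℝ :=
  (ball (0 : EuclideanSpace ℝ d) ℓ).indicator fun ξ =>
    novackKernelConst d ℓ * ((ℓ ^ 2 - ‖ξ‖ ^ 2) * (if i = j then 1 else 0) + ξ i * ξ j)

variable (d) in
/-- **The sharp pressure potential** `ζ̃_ℓ(ξ) = c_ℓ 1_{B_ℓ}(ξ)[|ξ|² − ((d−3)/2)(ℓ² − |ξ|²)]`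
`= |B_ℓ|⁻¹1_{B_ℓ}[1 − ((d−1)/2)(1 − |ξ|²/ℓ²)]`, the kernel of `Torus.longAvgPressure` (the `γ = 0`
member of `novackPotentialE d ℓ γ`). [cite: Novack2024, Sect. 2 Step 2, potentials ζ̃] -/
def novackPotentialE₀ (ℓ : ℝ) : EuclideanSpace ℝ d → ℝ :=
  (ball (0 : EuclideanSpace ℝ d) ℓ).indicator fun ξ =>
    novackKernelConst d ℓ * (‖ξ‖ ^ 2 - ((Fintype.card d : ℝ) - 3) / 2 * (ℓ ^ 2 - ‖ξ‖ ^ 2))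

omit [DecidableEq d] in
/-- The normalising constant is nonnegative. [folklore] -/
theorem novackKernelConst_nonneg (ℓ : ℝ) : 0 ≤ novackKernelConst d ℓ := by
  unfold novackKernelConst
  exact inv_nonneg.2 (mul_nonneg ENNReal.toReal_nonneg (sq_nonneg ℓ))

omit [Fintype d] [DecidableEq d] in
/-- The tail primitive is at most `ℓ² − s` for `s ≤ ℓ²` (`χ ≤ 1`). [folklore] -/
theorem novackCutoffPrim_le {s : ℝ} (hs : s ≤ ℓ ^ 2) : novackCutoffPrim ℓ γ s ≤ ℓ ^ 2 - s := by
  have h := intervalIntegral.integral_mono_on hs ((continuous_novackCutoff ℓ γ).intervalIntegrable _ _)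
    (intervalIntegrable_const (μ := volume) (c := (1 : ℝ))) fun σ _ => (novackCutoff_mem_Icc ℓ γ σ).2
  rwa [intervalIntegral.integral_const, smul_eq_mul, mul_one] at h

omit [Fintype d] [DecidableEq d] in
/-- The tail primitive is at least `ℓ²(1−γ) − s` for `s ≤ ℓ²(1−γ)` (`χ = 1` on the inner ball,
`χ ≥ 0`; `ℓ ≠ 0`, `0 < γ`). [folklore] -/
theorem le_novackCutoffPrim (hℓ : ℓ ≠ 0) (hγ : 0 < γ) {s : ℝ}
    (hs : s ≤ ℓ ^ 2 * (1 - γ)) : ℓ ^ 2 * (1 - γ) - s ≤ novackCutoffPrim ℓ γ s := by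
  have hc := continuous_novackCutoff ℓ γ
  have hm : ℓ ^ 2 * (1 - γ) ≤ ℓ ^ 2 := by nlinarith [sq_nonneg ℓ]
  rw [novackCutoffPrim, ← intervalIntegral.integral_add_adjacent_intervals (b := ℓ ^ 2 * (1 - γ))
    (hc.intervalIntegrable _ _) (hc.intervalIntegrable _ _)]
  have h1 : ∫ σ in s..ℓ ^ 2 * (1 - γ), novackCutoff ℓ γ σ = ℓ ^ 2 * (1 - γ) - s := by
    rw [intervalIntegral.integral_congr (g := fun _ => (1 : ℝ)), intervalIntegral.integral_const,
      smul_eq_mul, mul_one]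
    intro σ hσ
    rw [uIcc_of_le hs] at hσ
    exact novackCutoff_eq_one hℓ hγ hσ.2
  have h2 : 0 ≤ ∫ σ in ℓ ^ 2 * (1 - γ)..ℓ ^ 2, novackCutoff ℓ γ σ :=
    intervalIntegral.integral_nonneg hm fun σ _ => (novackCutoff_mem_Icc ℓ γ σ).1
  linarith

omit [Fintype d] [DecidableEq d] in
/-- **Pointwise convergence of the tail primitive**: `P_{ℓ,γ}(s) → ℓ² − s` as `γ → 0⁺`, for
`s < ℓ²`. [folklore] -/
theorem tendsto_novackCutoffPrim (hℓ : ℓ ≠ 0) {s : ℝ} (hs : s < ℓ ^ 2) :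
    Tendsto (fun γ => novackCutoffPrim ℓ γ s) (𝓝[>] 0) (𝓝 (ℓ ^ 2 - s)) := by
  have hℓ2 : 0 < ℓ ^ 2 := by positivity
  -- lower and upper envelopes
  have hlo : Tendsto (fun γ : ℝ => ℓ ^ 2 * (1 - γ) - s) (𝓝[>] 0) (𝓝 (ℓ ^ 2 - s)) := by
    have h : Tendsto (fun γ : ℝ => ℓ ^ 2 * (1 - γ) - s) (𝓝 0) (𝓝 (ℓ ^ 2 * (1 - 0) - s)) :=
      ((continuous_const.mul (continuous_const.sub continuous_id)).sub continuous_const).tendsto 0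
    rw [sub_zero, mul_one] at h
    exact h.mono_left nhdsWithin_le_nhds
  have hγ0 : 0 < 1 - s / ℓ ^ 2 := by
    rw [sub_pos, div_lt_one hℓ2]
    exact hs
  refine tendsto_of_tendsto_of_tendsto_of_le_of_le' hlo tendsto_const_nhds ?_ ?_
  · filter_upwards [Ioo_mem_nhdsGT (lt_min one_pos hγ0)] with γ hγ
    refine le_novackCutoffPrim hℓ hγ.1 ?_
    have h' : γ < 1 - s / ℓ ^ 2 := lt_of_lt_of_le hγ.2 (min_le_right _ _)
    have : s / ℓ ^ 2 * ℓ ^ 2 = s := div_mul_cancel₀ s hℓ2.ne'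
    nlinarith
  · filter_upwards [self_mem_nhdsWithin] with γ _
    exact novackCutoffPrim_le hs.le

omit [Fintype d] [DecidableEq d] in
/-- **Pointwise convergence of the cut-off**: `χ_{ℓ,γ}(s) → 1` as `γ → 0⁺` (indeed `= 1`
eventually), for `s < ℓ²`. [folklore] -/
theorem tendsto_novackCutoff (hℓ : ℓ ≠ 0) {s : ℝ} (hs : s < ℓ ^ 2) :
    Tendsto (fun γ => novackCutoff ℓ γ s) (𝓝[>] 0) (𝓝 1) := by
  have hℓ2 : 0 < ℓ ^ 2 := by positivity
  have hγ0 : 0 < 1 - s / ℓ ^ 2 := by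
    rw [sub_pos, div_lt_one hℓ2]
    exact hs
  refine tendsto_const_nhds.congr' ?_
  filter_upwards [Ioo_mem_nhdsGT hγ0] with γ hγ
  refine (novackCutoff_eq_one hℓ hγ.1 ?_).symm
  have : s / ℓ ^ 2 * ℓ ^ 2 = s := div_mul_cancel₀ s hℓ2.ne'
  nlinarith [hγ.2]

/-- **Pointwise convergence of the combined kernel to the sharp kernel**:
`M_{ℓ,γ}^{ij}(ξ) → M_ℓ^{ij}(ξ)` as `γ → 0⁺`, at every `ξ` (`0 < ℓ`). [folklore] -/
theorem tendsto_novackKernelE (hℓ : 0 < ℓ) (i j : d) (ξ : EuclideanSpace ℝ d) :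
    Tendsto (fun γ => novackKernelE ℓ γ i j ξ) (𝓝[>] 0) (𝓝 (novackKernelE₀ ℓ i j ξ)) := by
  by_cases hξ : ‖ξ‖ < ℓ
  · have hs : ‖ξ‖ ^ 2 < ℓ ^ 2 := by
      exact pow_lt_pow_left₀ hξ (norm_nonneg _) two_ne_zero
    have hmem : ξ ∈ ball (0 : EuclideanSpace ℝ d) ℓ := by rwa [mem_ball, dist_zero_right]
    rw [novackKernelE₀, indicator_of_mem hmem]
    have h := (((tendsto_novackCutoffPrim hℓ.ne' hs).mul_const (if i = j then (1 : ℝ) else 0)).add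
      ((tendsto_novackCutoff hℓ.ne' hs).mul_const (ξ i * ξ j))).const_mul (novackKernelConst d ℓ)
    rw [one_mul] at h
    exact h
  · have hmem : ξ ∉ ball (0 : EuclideanSpace ℝ d) ℓ := by rwa [mem_ball, dist_zero_right]
    rw [novackKernelE₀, indicator_of_notMem hmem]
    refine tendsto_const_nhds.congr' ?_
    filter_upwards [self_mem_nhdsWithin] with γ hγ
    exact (novackKernelE_eq_zero hℓ hγ i j (not_lt.1 hξ)).symm

omit [DecidableEq d] in
/-- **Pointwise convergence of the potential to the sharp potential**: `ζ̃_{ℓ,γ}(ξ) → ζ̃_ℓ(ξ)`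
as `γ → 0⁺`, at every `ξ`. [folklore] -/
theorem tendsto_novackPotentialE (hℓ : 0 < ℓ) (ξ : EuclideanSpace ℝ d) :
    Tendsto (fun γ => novackPotentialE d ℓ γ ξ) (𝓝[>] 0) (𝓝 (novackPotentialE₀ d ℓ ξ)) := by
  by_cases hξ : ‖ξ‖ < ℓ
  · have hs : ‖ξ‖ ^ 2 < ℓ ^ 2 := pow_lt_pow_left₀ hξ (norm_nonneg _) two_ne_zero
    have hmem : ξ ∈ ball (0 : EuclideanSpace ℝ d) ℓ := by rwa [mem_ball, dist_zero_right]
    rw [novackPotentialE₀, indicator_of_mem hmem]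
    unfold novackPotentialE
    have h := ((tendsto_const_nhds (x := ‖ξ‖ ^ 2)).mul (tendsto_novackCutoff hℓ.ne' hs)).sub
      ((tendsto_const_nhds (x := ((Fintype.card d : ℝ) - 3) / 2)).mul
        (tendsto_novackCutoffPrim hℓ.ne' hs))
    rw [mul_one] at h
    exact h.const_mul _
  · have hmem : ξ ∉ ball (0 : EuclideanSpace ℝ d) ℓ := by rwa [mem_ball, dist_zero_right]
    rw [novackPotentialE₀, indicator_of_notMem hmem]
    refine tendsto_const_nhds.congr' ?_
    filter_upwards [self_mem_nhdsWithin] with γ hγ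
    exact (novackPotentialE_eq_zero hℓ hγ (not_lt.1 hξ)).symm

/-- **Uniform bound on the combined kernel**: `|M_{ℓ,γ}^{ij}(ξ)| ≤ 2c_ℓℓ²` (`0 < ℓ`, `0 < γ`). [folklore] -/
theorem abs_novackKernelE_le (hℓ : 0 < ℓ) (hγ : 0 < γ) (i j : d) (ξ : EuclideanSpace ℝ d) :
    ‖novackKernelE ℓ γ i j ξ‖ ≤ 2 * novackKernelConst d ℓ * ℓ ^ 2 := by
  have hc := novackKernelConst_nonneg (d := d) ℓ
  by_cases hξ : ℓ ≤ ‖ξ‖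
  · rw [novackKernelE_eq_zero hℓ hγ i j hξ, norm_zero]; positivity
  · have hs : ‖ξ‖ ^ 2 ≤ ℓ ^ 2 := by
      exact pow_le_pow_left₀ (norm_nonneg _) (not_le.1 hξ).le 2
    have hP0 : 0 ≤ novackCutoffPrim ℓ γ (‖ξ‖ ^ 2) := novackCutoffPrim_nonneg ℓ γ _ hs
    have hP1 : novackCutoffPrim ℓ γ (‖ξ‖ ^ 2) ≤ ℓ ^ 2 := (novackCutoffPrim_le hs).trans (by nlinarith)
    have hχ := novackCutoff_mem_Icc ℓ γ (‖ξ‖ ^ 2)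
    have hij : |ξ i * ξ j| ≤ ℓ ^ 2 := by
      rw [abs_mul]
      have hi : |ξ i| ≤ ‖ξ‖ := by simpa using PiLp.norm_apply_le ξ i
      have hj : |ξ j| ≤ ‖ξ‖ := by simpa using PiLp.norm_apply_le ξ j
      calc |ξ i| * |ξ j| ≤ ‖ξ‖ * ‖ξ‖ := mul_le_mul hi hj (abs_nonneg _) (norm_nonneg _)
        _ = ‖ξ‖ ^ 2 := (sq ‖ξ‖).symm
        _ ≤ ℓ ^ 2 := hs
    have hδ : |(if i = j then (1 : ℝ) else 0)| ≤ 1 := by split_ifs <;> simp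
    rw [novackKernelE, Real.norm_eq_abs, abs_mul, abs_of_nonneg hc]
    calc novackKernelConst d ℓ * |novackCutoffPrim ℓ γ (‖ξ‖ ^ 2) * (if i = j then 1 else 0) +
          novackCutoff ℓ γ (‖ξ‖ ^ 2) * (ξ i * ξ j)|
        ≤ novackKernelConst d ℓ * (ℓ ^ 2 * 1 + 1 * ℓ ^ 2) := by
          gcongr
          refine (abs_add_le _ _).trans (add_le_add ?_ ?_)
          · rw [abs_mul, abs_of_nonneg hP0]
            exact mul_le_mul hP1 hδ (abs_nonneg _) (sq_nonneg ℓ)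
          · rw [abs_mul, abs_of_nonneg hχ.1]
            exact mul_le_mul hχ.2 hij (abs_nonneg _) zero_le_one
      _ = 2 * novackKernelConst d ℓ * ℓ ^ 2 := by ring

/-- **Uniform bound on the sharp kernel**: `|M_ℓ^{ij}(ξ)| ≤ 2c_ℓℓ²`. [folklore] -/
theorem abs_novackKernelE₀_le (i j : d) (ξ : EuclideanSpace ℝ d) :
    ‖novackKernelE₀ ℓ i j ξ‖ ≤ 2 * novackKernelConst d ℓ * ℓ ^ 2 := by
  have hc := novackKernelConst_nonneg (d := d) ℓ
  rw [novackKernelE₀]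
  by_cases hmem : ξ ∈ ball (0 : EuclideanSpace ℝ d) ℓ
  · rw [indicator_of_mem hmem, Real.norm_eq_abs, abs_mul, abs_of_nonneg hc]
    have hξ : ‖ξ‖ < ℓ := by rwa [mem_ball, dist_zero_right] at hmem
    have hs : ‖ξ‖ ^ 2 ≤ ℓ ^ 2 := pow_le_pow_left₀ (norm_nonneg _) hξ.le 2
    have hij : |ξ i * ξ j| ≤ ℓ ^ 2 := by
      rw [abs_mul]
      have hi : |ξ i| ≤ ‖ξ‖ := by simpa using PiLp.norm_apply_le ξ i
      have hj : |ξ j| ≤ ‖ξ‖ := by simpa using PiLp.norm_apply_le ξ j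
      calc |ξ i| * |ξ j| ≤ ‖ξ‖ * ‖ξ‖ := mul_le_mul hi hj (abs_nonneg _) (norm_nonneg _)
        _ = ‖ξ‖ ^ 2 := (sq ‖ξ‖).symm
        _ ≤ ℓ ^ 2 := hs
    have hδ : |(if i = j then (1 : ℝ) else 0)| ≤ 1 := by split_ifs <;> simp
    calc novackKernelConst d ℓ * |(ℓ ^ 2 - ‖ξ‖ ^ 2) * (if i = j then 1 else 0) + ξ i * ξ j|
        ≤ novackKernelConst d ℓ * (ℓ ^ 2 * 1 + ℓ ^ 2) := by
          gcongr
          refine (abs_add_le _ _).trans (add_le_add ?_ hij)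
          rw [abs_mul, abs_of_nonneg (by nlinarith)]
          exact mul_le_mul (by nlinarith [sq_nonneg ‖ξ‖]) hδ (abs_nonneg _) (sq_nonneg ℓ)
      _ = 2 * novackKernelConst d ℓ * ℓ ^ 2 := by ring
  · rw [indicator_of_notMem hmem, norm_zero]; positivity

omit [DecidableEq d] in
/-- **Uniform bound on the potential**: `|ζ̃_{ℓ,γ}(ξ)| ≤ c_ℓℓ²(1 + |d−3|/2)` (`0 < ℓ`, `0 < γ`). [folklore] -/
theorem abs_novackPotentialE_le (hℓ : 0 < ℓ) (hγ : 0 < γ) (ξ : EuclideanSpace ℝ d) :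
    ‖novackPotentialE d ℓ γ ξ‖ ≤
      novackKernelConst d ℓ * ℓ ^ 2 * (1 + |((Fintype.card d : ℝ) - 3) / 2|) := by
  have hc := novackKernelConst_nonneg (d := d) ℓ
  by_cases hξ : ℓ ≤ ‖ξ‖
  · rw [novackPotentialE_eq_zero hℓ hγ hξ, norm_zero]; positivity
  · have hs : ‖ξ‖ ^ 2 ≤ ℓ ^ 2 := pow_le_pow_left₀ (norm_nonneg _) (not_le.1 hξ).le 2
    have hP0 : 0 ≤ novackCutoffPrim ℓ γ (‖ξ‖ ^ 2) := novackCutoffPrim_nonneg ℓ γ _ hs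
    have hP1 : novackCutoffPrim ℓ γ (‖ξ‖ ^ 2) ≤ ℓ ^ 2 := (novackCutoffPrim_le hs).trans (by nlinarith)
    have hχ := novackCutoff_mem_Icc ℓ γ (‖ξ‖ ^ 2)
    rw [novackPotentialE, Real.norm_eq_abs, abs_mul, abs_of_nonneg hc, mul_assoc]
    gcongr
    set κ : ℝ := ((Fintype.card d : ℝ) - 3) / 2 with hκ
    calc |‖ξ‖ ^ 2 * novackCutoff ℓ γ (‖ξ‖ ^ 2) - κ * novackCutoffPrim ℓ γ (‖ξ‖ ^ 2)|
        ≤ |‖ξ‖ ^ 2 * novackCutoff ℓ γ (‖ξ‖ ^ 2)| + |κ * novackCutoffPrim ℓ γ (‖ξ‖ ^ 2)| := abs_sub _ _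
      _ = ‖ξ‖ ^ 2 * novackCutoff ℓ γ (‖ξ‖ ^ 2) + |κ| * novackCutoffPrim ℓ γ (‖ξ‖ ^ 2) := by
          rw [abs_mul, abs_of_nonneg (sq_nonneg _), abs_of_nonneg hχ.1, abs_mul, abs_of_nonneg hP0]
      _ ≤ ℓ ^ 2 * 1 + |κ| * ℓ ^ 2 := by
          gcongr
          · exact hχ.1
          · exact hχ.2
      _ = ℓ ^ 2 * (1 + |κ|) := by ring

omit [DecidableEq d] in
/-- **Uniform bound on the sharp potential**: `|ζ̃_ℓ(ξ)| ≤ c_ℓℓ²(1 + |d−3|/2)`. [folklore] -/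
theorem abs_novackPotentialE₀_le (ξ : EuclideanSpace ℝ d) :
    ‖novackPotentialE₀ d ℓ ξ‖ ≤
      novackKernelConst d ℓ * ℓ ^ 2 * (1 + |((Fintype.card d : ℝ) - 3) / 2|) := by
  have hc := novackKernelConst_nonneg (d := d) ℓ
  rw [novackPotentialE₀]
  by_cases hmem : ξ ∈ ball (0 : EuclideanSpace ℝ d) ℓ
  · rw [indicator_of_mem hmem, Real.norm_eq_abs, abs_mul, abs_of_nonneg hc, mul_assoc]
    have hξ : ‖ξ‖ < ℓ := by rwa [mem_ball, dist_zero_right] at hmem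
    have hs : ‖ξ‖ ^ 2 ≤ ℓ ^ 2 := pow_le_pow_left₀ (norm_nonneg _) hξ.le 2
    gcongr
    set κ : ℝ := ((Fintype.card d : ℝ) - 3) / 2 with hκ
    calc |‖ξ‖ ^ 2 - κ * (ℓ ^ 2 - ‖ξ‖ ^ 2)| ≤ |‖ξ‖ ^ 2| + |κ * (ℓ ^ 2 - ‖ξ‖ ^ 2)| := abs_sub _ _
      _ = ‖ξ‖ ^ 2 + |κ| * (ℓ ^ 2 - ‖ξ‖ ^ 2) := by
          rw [abs_of_nonneg (sq_nonneg _), abs_mul,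
            abs_of_nonneg (show (0 : ℝ) ≤ ℓ ^ 2 - ‖ξ‖ ^ 2 by linarith)]
      _ ≤ ℓ ^ 2 + |κ| * ℓ ^ 2 := by
          gcongr
          nlinarith [sq_nonneg ‖ξ‖]
      _ = ℓ ^ 2 * (1 + |κ|) := by ring
  · rw [indicator_of_notMem hmem, norm_zero]; positivity

/-- The sharp kernel is supported in the closed ball of radius `ℓ`. [folklore] -/
theorem support_novackKernelE₀_subset (ℓ : ℝ) (i j : d) :
    support (novackKernelE₀ ℓ i j) ⊆ closedBall (0 : EuclideanSpace ℝ d) ℓ :=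
  (support_indicator_subset).trans ball_subset_closedBall

omit [DecidableEq d] in
/-- The sharp potential is supported in the closed ball of radius `ℓ`. [folklore] -/
theorem support_novackPotentialE₀_subset (ℓ : ℝ) :
    support (novackPotentialE₀ d ℓ) ⊆ closedBall (0 : EuclideanSpace ℝ d) ℓ :=
  (support_indicator_subset).trans ball_subset_closedBall

/-- The sharp kernel is measurable. [folklore] -/
theorem measurable_novackKernelE₀ (ℓ : ℝ) (i j : d) : Measurable (novackKernelE₀ ℓ i j) := by
  refine (Continuous.measurable ?_).indicator measurableSet_ball
  exact continuous_const.mul (((continuous_const.sub (continuous_norm.pow 2)).mul continuous_const).add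
    ((PiLp.continuous_apply 2 _ i).mul (PiLp.continuous_apply 2 _ j)))

omit [DecidableEq d] in
/-- The sharp potential is measurable. [folklore] -/
theorem measurable_novackPotentialE₀ (ℓ : ℝ) : Measurable (novackPotentialE₀ d ℓ) := by
  refine (Continuous.measurable ?_).indicator measurableSet_ball
  exact continuous_const.mul ((continuous_norm.pow 2).sub
    (continuous_const.mul (continuous_const.sub (continuous_norm.pow 2))))

/-- **`L¹` convergence of the combined kernel to the sharp kernel** (Novack's "dominated
convergence theorem", Step 2): `∫ |M_{ℓ,γ}^{ij} − M_ℓ^{ij}| → 0` as `γ → 0⁺`. [cite: Novack2024, Sect. 2 Step 2, limit γ → 0 (dominated convergence)] -/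
theorem tendsto_lintegral_novackKernelE_sub (hℓ : 0 < ℓ) (i j : d) :
    Tendsto (fun γ => ∫⁻ ξ, ‖novackKernelE ℓ γ i j ξ - novackKernelE₀ ℓ i j ξ‖ₑ) (𝓝[>] 0) (𝓝 0) := by
  set C : ℝ := 2 * novackKernelConst d ℓ * ℓ ^ 2 with hC
  set bound : EuclideanSpace ℝ d → ℝ≥0∞ :=
    (closedBall (0 : EuclideanSpace ℝ d) ℓ).indicator fun _ => ENNReal.ofReal (C + C) with hbound
  have h0 : ∫⁻ ξ : EuclideanSpace ℝ d, (0 : ℝ≥0∞) = 0 := lintegral_zero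
  rw [← h0]
  refine tendsto_lintegral_filter_of_dominated_convergence bound ?_ ?_ ?_ ?_
  · filter_upwards [self_mem_nhdsWithin] with γ _
    exact ((contDiff_novackKernelE ℓ γ i j).continuous.measurable.sub
      (measurable_novackKernelE₀ ℓ i j)).enorm
  · filter_upwards [self_mem_nhdsWithin] with γ hγ
    refine ae_of_all _ fun ξ => ?_
    by_cases hmem : ξ ∈ closedBall (0 : EuclideanSpace ℝ d) ℓ
    · rw [hbound, indicator_of_mem hmem, ← ofReal_norm]
      refine ENNReal.ofReal_le_ofReal ((norm_sub_le _ _).trans (add_le_add ?_ ?_))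
      · exact abs_novackKernelE_le hℓ hγ i j ξ
      · exact abs_novackKernelE₀_le i j ξ
    · have h1 : novackKernelE ℓ γ i j ξ = 0 :=
        notMem_support.1 fun h => hmem (tsupport_novackKernelE_subset hℓ hγ i j (subset_tsupport _ h))
      have h2 : novackKernelE₀ ℓ i j ξ = 0 :=
        notMem_support.1 fun h => hmem (support_novackKernelE₀_subset ℓ i j h)
      rw [h1, h2, sub_zero, enorm_zero]
      exact zero_le
  · rw [hbound, lintegral_indicator_const measurableSet_closedBall]
    exact ENNReal.mul_ne_top ENNReal.ofReal_ne_top measure_closedBall_lt_top.ne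
  · refine ae_of_all _ fun ξ => ?_
    have h := (tendsto_novackKernelE hℓ i j ξ).sub_const (novackKernelE₀ ℓ i j ξ)
    rw [sub_self] at h
    have h' := (continuous_enorm.tendsto (0 : ℝ)).comp h
    rwa [enorm_zero] at h'

omit [DecidableEq d] in
/-- **`L¹` convergence of the potential to the sharp potential**: `∫ |ζ̃_{ℓ,γ} − ζ̃_ℓ| → 0`
as `γ → 0⁺`. [cite: Novack2024, Sect. 2 Step 2, limit γ → 0 (dominated convergence)] -/
theorem tendsto_lintegral_novackPotentialE_sub [DecidableEq d] (hℓ : 0 < ℓ) :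
    Tendsto (fun γ => ∫⁻ ξ, ‖novackPotentialE d ℓ γ ξ - novackPotentialE₀ d ℓ ξ‖ₑ) (𝓝[>] 0) (𝓝 0) := by
  set C : ℝ := novackKernelConst d ℓ * ℓ ^ 2 * (1 + |((Fintype.card d : ℝ) - 3) / 2|) with hC
  set bound : EuclideanSpace ℝ d → ℝ≥0∞ :=
    (closedBall (0 : EuclideanSpace ℝ d) ℓ).indicator fun _ => ENNReal.ofReal (C + C) with hbound
  have h0 : ∫⁻ ξ : EuclideanSpace ℝ d, (0 : ℝ≥0∞) = 0 := lintegral_zero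
  rw [← h0]
  refine tendsto_lintegral_filter_of_dominated_convergence bound ?_ ?_ ?_ ?_
  · filter_upwards [self_mem_nhdsWithin] with γ _
    exact ((contDiff_novackPotentialE (d := d) ℓ γ).continuous.measurable.sub
      (measurable_novackPotentialE₀ ℓ)).enorm
  · filter_upwards [self_mem_nhdsWithin] with γ hγ
    refine ae_of_all _ fun ξ => ?_
    by_cases hmem : ξ ∈ closedBall (0 : EuclideanSpace ℝ d) ℓ
    · rw [hbound, indicator_of_mem hmem, ← ofReal_norm]
      refine ENNReal.ofReal_le_ofReal ((norm_sub_le _ _).trans (add_le_add ?_ ?_))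
      · exact abs_novackPotentialE_le hℓ hγ ξ
      · exact abs_novackPotentialE₀_le ξ
    · have h1 : novackPotentialE d ℓ γ ξ = 0 :=
        notMem_support.1 fun h => hmem (tsupport_novackPotentialE_subset hℓ hγ (subset_tsupport _ h))
      have h2 : novackPotentialE₀ d ℓ ξ = 0 :=
        notMem_support.1 fun h => hmem (support_novackPotentialE₀_subset ℓ h)
      rw [h1, h2, sub_zero, enorm_zero]
      exact zero_le
  · rw [hbound, lintegral_indicator_const measurableSet_closedBall]
    exact ENNReal.mul_ne_top ENNReal.ofReal_ne_top measure_closedBall_lt_top.ne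
  · refine ae_of_all _ fun ξ => ?_
    have h := (tendsto_novackPotentialE hℓ ξ).sub_const (novackPotentialE₀ d ℓ ξ)
    rw [sub_self] at h
    have h' := (continuous_enorm.tendsto (0 : ℝ)).comp h
    rwa [enorm_zero] at h'

end SharpKernel

/-! ## The sharp kernel averages are the objects of `NovackLongitudinalBalance` -/

section Identification

variable {ℓ : ℝ} {v : UnitAddTorus d → EuclideanSpace ℝ d} {q : UnitAddTorus d → ℝ}

omit [DecidableEq d] in
/-- The lift `ξ ↦ f(x + πξ)` of an integrable function is integrable on the ball `B_ℓ`. [folklore] -/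
theorem integrableOn_translate_ball [DecidableEq d] {F : Type*} [NormedAddCommGroup F] {f : UnitAddTorus d → F}
    (hf : Integrable f volume) (x : UnitAddTorus d) (ℓ : ℝ) :
    IntegrableOn (fun ξ : EuclideanSpace ℝ d => f (x + FunctionSpaces.Torus.proj ξ)) (ball 0 ℓ) volume :=
  FunctionSpaces.Torus.integrableOn_lift_of_subset_closedBall (hf.comp_add_left x) ball_subset_closedBall

omit [DecidableEq d] in
/-- The volume of the ball `B_ℓ` is positive and `c_ℓ |B_ℓ| ℓ² = 1` (`d` nonempty, `0 < ℓ`). [folklore] -/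
theorem novackKernelConst_mul_volume_real (hℓ : 0 < ℓ) [Nonempty d] :
    0 < (volume : Measure (EuclideanSpace ℝ d)).real (ball 0 ℓ) ∧
      novackKernelConst d ℓ * ((volume : Measure (EuclideanSpace ℝ d)).real (ball 0 ℓ) * ℓ ^ 2) = 1 := by
  have hB : 0 < (volume : Measure (EuclideanSpace ℝ d)).real (ball 0 ℓ) :=
    ENNReal.toReal_pos (measure_ball_pos volume _ hℓ).ne' measure_ball_lt_top.ne
  refine ⟨hB, ?_⟩
  rw [novackKernelConst, Measure.real, inv_mul_cancel₀]
  exact mul_ne_zero hB.ne' (by positivity)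

omit [DecidableEq d] in
/-- `c_ℓ = |B_ℓ|⁻¹ ℓ⁻²`. [folklore] -/
theorem novackKernelConst_eq (ℓ : ℝ) :
    novackKernelConst d ℓ = ((volume : Measure (EuclideanSpace ℝ d)).real (ball 0 ℓ))⁻¹ * (ℓ ^ 2)⁻¹ := by
  rw [novackKernelConst, Measure.real, mul_inv]

/-- Contraction of one row of the sharp kernel: `∑ⱼ c[Aδᵢⱼ + ξᵢξⱼ] gⱼ = c(A gᵢ + ξᵢ ∑ⱼ ξⱼ gⱼ)`. [folklore] -/
theorem sum_sharpRow_mul (c A : ℝ) (ξ : EuclideanSpace ℝ d) (i : d) (g : d → ℝ) :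
    ∑ j, c * (A * (if i = j then 1 else 0) + ξ i * ξ j) * g j = c * (A * g i + ξ i * ∑ j, ξ j * g j) := by
  have e : ∀ j, c * (A * (if i = j then 1 else 0) + ξ i * ξ j) * g j =
      (if i = j then c * A * g j else 0) + c * ξ i * (ξ j * g j) := fun j => by
    split_ifs <;> ring
  rw [Finset.sum_congr rfl fun j _ => e j, Finset.sum_add_distrib, Finset.sum_ite_eq, ← Finset.mul_sum]
  simp only [Finset.mem_univ, if_true]
  ring

omit [DecidableEq d] in
/-- The real inner product on `ℝ^d` in coordinates: `⟪ξ, a⟫ = ∑ⱼ ξⱼ aⱼ`. [folklore] -/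
theorem real_inner_eq_sum_mul (ξ a : EuclideanSpace ℝ d) : ⟪ξ, a⟫ = ∑ j, ξ j * a j := by
  rw [PiLp.inner_apply]
  exact Finset.sum_congr rfl fun j _ => by rw [RCLike.inner_apply, conj_trivial, mul_comm]

omit [DecidableEq d] in
/-- Bounds for the coefficients of the `longAvg*` integrands on the ball:
`|1 − |ξ|²/ℓ²| ≤ 1` and `⟪ξ, a⟫² ≤ ℓ²|a|²` for `|ξ| < ℓ`. [folklore] -/
theorem longAvg_coeff_bounds (hℓ : 0 < ℓ) {ξ : EuclideanSpace ℝ d} (hξ : ‖ξ‖ < ℓ) (a : EuclideanSpace ℝ d) :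
    |1 - ‖ξ‖ ^ 2 / ℓ ^ 2| ≤ 1 ∧ ⟪ξ, a⟫ ^ 2 ≤ ℓ ^ 2 * ‖a‖ ^ 2 ∧ |⟪ξ, a⟫| * ‖ξ‖ ≤ ℓ ^ 2 * ‖a‖ := by
  have h1 : ‖ξ‖ ^ 2 / ℓ ^ 2 ≤ 1 := by
    rw [div_le_one (by positivity)]
    exact pow_le_pow_left₀ (norm_nonneg _) hξ.le 2
  have h0 : 0 ≤ ‖ξ‖ ^ 2 / ℓ ^ 2 := by positivity
  have hi : |⟪ξ, a⟫| ≤ ‖ξ‖ * ‖a‖ := abs_real_inner_le_norm _ _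
  refine ⟨?_, ?_, ?_⟩
  · rw [abs_of_nonneg (by linarith)]; linarith
  · calc ⟪ξ, a⟫ ^ 2 = |⟪ξ, a⟫| ^ 2 := (sq_abs _).symm
      _ ≤ (‖ξ‖ * ‖a‖) ^ 2 := by gcongr
      _ = ‖ξ‖ ^ 2 * ‖a‖ ^ 2 := by ring
      _ ≤ ℓ ^ 2 * ‖a‖ ^ 2 := by gcongr
  · calc |⟪ξ, a⟫| * ‖ξ‖ ≤ (‖ξ‖ * ‖a‖) * ‖ξ‖ := by gcongr
      _ = ‖ξ‖ ^ 2 * ‖a‖ := by ring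
      _ ≤ ℓ ^ 2 * ‖a‖ := by gcongr

/-- **The sharp kernel average of a velocity slice is Novack's longitudinal average**
((you:ell:ell)): for `v ∈ L¹(T^d)`, `0 < ℓ` and every `x`, componentwise,
`(u_{L,ℓ})ᵢ(x) = ∑ⱼ ∫ M_ℓ^{ij}(ξ) vⱼ(x + πξ) dξ` (`Torus.longAvg`). [cite: Novack2024, Sect. 2 Step 2 (you:ell:ell)] -/
theorem longAvg_apply_eq_sum_integral [Nonempty d] (hℓ : 0 < ℓ) (hv : Integrable v volume)
    (x : UnitAddTorus d) (i : d) :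
    longAvg v ℓ x i = ∑ j, ∫ ξ, novackKernelE₀ ℓ i j ξ * v (x + FunctionSpaces.Torus.proj ξ) j := by
  obtain ⟨hB, -⟩ := novackKernelConst_mul_volume_real (d := d) hℓ
  have hcV := novackKernelConst_eq (d := d) ℓ
  set B := ball (0 : EuclideanSpace ℝ d) ℓ with hBdef
  set Vol := (volume : Measure (EuclideanSpace ℝ d)).real B with hVol
  have hℓ2 : ℓ ^ 2 ≠ 0 := by positivity
  -- the integrand of `longAvg` and its integrability on the ball
  set F : EuclideanSpace ℝ d → EuclideanSpace ℝ d := fun ξ =>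
    (1 - ‖ξ‖ ^ 2 / ℓ ^ 2) • v (x + FunctionSpaces.Torus.proj ξ) +
      (ℓ ^ 2)⁻¹ • ⟪ξ, v (x + FunctionSpaces.Torus.proj ξ)⟫ • ξ with hF
  have hvB : IntegrableOn (fun ξ : EuclideanSpace ℝ d => v (x + FunctionSpaces.Torus.proj ξ)) B volume :=
    integrableOn_translate_ball hv x ℓ
  have hvm : AEStronglyMeasurable (fun ξ : EuclideanSpace ℝ d => v (x + FunctionSpaces.Torus.proj ξ))
      (volume.restrict B) := hvB.aestronglyMeasurable
  have hF1 : IntegrableOn (fun ξ : EuclideanSpace ℝ d => (1 - ‖ξ‖ ^ 2 / ℓ ^ 2) • v (x + FunctionSpaces.Torus.proj ξ)) B volume := by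
    refine Integrable.mono' (hvB.norm) ?_ ?_
    · exact ((continuous_const.sub ((continuous_norm.pow 2).div_const _)).aestronglyMeasurable).smul hvm
    · filter_upwards [ae_restrict_mem measurableSet_ball] with ξ hξ
      rw [hBdef, mem_ball, dist_zero_right] at hξ
      rw [norm_smul, Real.norm_eq_abs]
      exact mul_le_of_le_one_left (norm_nonneg _) (longAvg_coeff_bounds hℓ hξ 0).1
  have hF2 : IntegrableOn (fun ξ : EuclideanSpace ℝ d =>
      (ℓ ^ 2)⁻¹ • ⟪ξ, v (x + FunctionSpaces.Torus.proj ξ)⟫ • ξ) B volume := by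
    have hm : AEStronglyMeasurable (fun ξ : EuclideanSpace ℝ d =>
        (ℓ ^ 2)⁻¹ • ⟪ξ, v (x + FunctionSpaces.Torus.proj ξ)⟫ • ξ) (volume.restrict B) :=
      ((continuous_id.aestronglyMeasurable.inner (𝕜 := ℝ) hvm).smul
        continuous_id.aestronglyMeasurable).const_smul ((ℓ ^ 2)⁻¹)
    refine Integrable.mono' ((hvB.norm).const_mul ((ℓ ^ 2)⁻¹ * ℓ ^ 2)) hm ?_
    filter_upwards [ae_restrict_mem measurableSet_ball] with ξ hξ
    rw [hBdef, mem_ball, dist_zero_right] at hξ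
    have h3 := (longAvg_coeff_bounds hℓ hξ (v (x + FunctionSpaces.Torus.proj ξ))).2.2
    rw [norm_smul, norm_smul, Real.norm_eq_abs, abs_of_nonneg (by positivity), Real.norm_eq_abs]
    calc (ℓ ^ 2)⁻¹ * (|⟪ξ, v (x + FunctionSpaces.Torus.proj ξ)⟫| * ‖ξ‖)
        ≤ (ℓ ^ 2)⁻¹ * (ℓ ^ 2 * ‖v (x + FunctionSpaces.Torus.proj ξ)‖) := by gcongr
      _ = (ℓ ^ 2)⁻¹ * ℓ ^ 2 * ‖v (x + FunctionSpaces.Torus.proj ξ)‖ := by ring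
  have hFint : IntegrableOn F B volume := hF1.add hF2
  -- left-hand side: the `i`-th component of the ball average
  have hL : longAvg v ℓ x i = Vol⁻¹ * ∫ ξ in B, F ξ i := by
    rw [longAvg, ← hBdef, setAverage_eq, ← hVol]
    change (EuclideanSpace.proj i : EuclideanSpace ℝ d →L[ℝ] ℝ) (Vol⁻¹ • ∫ ξ in B, F ξ) = _
    rw [map_smul, smul_eq_mul, ← (EuclideanSpace.proj i : EuclideanSpace ℝ d →L[ℝ] ℝ).integral_comp_comm hFint]
    rfl
  -- right-hand side: collect the kernel entries
  have hvj : ∀ j, Integrable (fun y => v y j) volume := fun j => hv.eval_piLp j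
  have hint : ∀ j, Integrable (fun ξ => novackKernelE₀ ℓ i j ξ * v (x + FunctionSpaces.Torus.proj ξ) j) volume :=
    fun j => by
    simpa only [smul_eq_mul] using integrable_kernel_smul_translate
      (measurable_novackKernelE₀ ℓ i j).aestronglyMeasurable (abs_novackKernelE₀_le i j)
      (support_novackKernelE₀_subset ℓ i j) (hvj j) x
  have hpt : ∀ ξ, ∑ j, novackKernelE₀ ℓ i j ξ * v (x + FunctionSpaces.Torus.proj ξ) j =
      B.indicator (fun ξ => Vol⁻¹ * F ξ i) ξ := by
    intro ξ
    by_cases hξ : ξ ∈ B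
    · simp only [novackKernelE₀, ← hBdef, indicator_of_mem hξ]
      rw [sum_sharpRow_mul, ← real_inner_eq_sum_mul, hcV]
      simp only [hF, PiLp.add_apply, PiLp.smul_apply, smul_eq_mul]
      field_simp
    · simp only [novackKernelE₀, ← hBdef, indicator_of_notMem hξ, zero_mul, Finset.sum_const_zero]
  have hR : ∑ j, ∫ ξ, novackKernelE₀ ℓ i j ξ * v (x + FunctionSpaces.Torus.proj ξ) j =
      ∫ ξ, B.indicator (fun ξ => Vol⁻¹ * F ξ i) ξ := by
    rw [← integral_finsetSum _ fun j _ => hint j]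
    exact integral_congr_ae (ae_of_all _ hpt)
  rw [hL, hR, integral_indicator measurableSet_ball, integral_const_mul]

/-- **The sharp quadratic average is Novack's `(|u_L|²)_ℓ`** ((increments c) with the kernel of
(you:ell:ell)): for `v ∈ L¹ ∩ L²(T^d)` (as `|v|² ∈ L¹`), `0 < ℓ` and every `x`,
`(|u_L|²)_ℓ(x) = ∑ᵢⱼ ∫ M_ℓ^{ij}(ξ) vᵢvⱼ(x + πξ) dξ` (`Torus.longAvgSq`). [cite: Novack2024, Sect. 2 Step 2 (you:ell:ell)] -/
theorem longAvgSq_eq_sum_integral [Nonempty d] (hℓ : 0 < ℓ) (hv : Integrable v volume)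
    (hv2 : Integrable (fun y => ‖v y‖ ^ 2) volume) (x : UnitAddTorus d) :
    longAvgSq v ℓ x = ∑ i, ∑ j, ∫ ξ, novackKernelE₀ ℓ i j ξ *
      (v (x + FunctionSpaces.Torus.proj ξ) i * v (x + FunctionSpaces.Torus.proj ξ) j) := by
  obtain ⟨hB, -⟩ := novackKernelConst_mul_volume_real (d := d) hℓ
  have hcV := novackKernelConst_eq (d := d) ℓ
  set B := ball (0 : EuclideanSpace ℝ d) ℓ with hBdef
  set Vol := (volume : Measure (EuclideanSpace ℝ d)).real B with hVol
  have hℓ2 : ℓ ^ 2 ≠ 0 := by positivity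
  set F : EuclideanSpace ℝ d → ℝ := fun ξ =>
    (1 - ‖ξ‖ ^ 2 / ℓ ^ 2) * ‖v (x + FunctionSpaces.Torus.proj ξ)‖ ^ 2 +
      (ℓ ^ 2)⁻¹ * ⟪ξ, v (x + FunctionSpaces.Torus.proj ξ)⟫ ^ 2 with hF
  have hvmeas : ∀ j, AEStronglyMeasurable (fun y => v y j) volume := fun j =>
    (EuclideanSpace.proj (𝕜 := ℝ) j).continuous.comp_aestronglyMeasurable hv.aestronglyMeasurable
  have hvij : ∀ i j, Integrable (fun y => v y i * v y j) volume := fun i j => by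
    refine hv2.mono' ((hvmeas i).mul (hvmeas j)) (ae_of_all _ fun y => ?_)
    rw [norm_mul]
    calc ‖v y i‖ * ‖v y j‖ ≤ ‖v y‖ * ‖v y‖ :=
          mul_le_mul (PiLp.norm_apply_le _ _) (PiLp.norm_apply_le _ _) (norm_nonneg _) (norm_nonneg _)
      _ = ‖v y‖ ^ 2 := (sq _).symm
  have hint : ∀ i j, Integrable (fun ξ => novackKernelE₀ ℓ i j ξ *
      (v (x + FunctionSpaces.Torus.proj ξ) i * v (x + FunctionSpaces.Torus.proj ξ) j)) volume := fun i j => by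
    simpa only [smul_eq_mul] using integrable_kernel_smul_translate
      (measurable_novackKernelE₀ ℓ i j).aestronglyMeasurable (abs_novackKernelE₀_le i j)
      (support_novackKernelE₀_subset ℓ i j) (hvij i j) x
  have hpt : ∀ ξ, ∑ i, ∑ j, novackKernelE₀ ℓ i j ξ *
        (v (x + FunctionSpaces.Torus.proj ξ) i * v (x + FunctionSpaces.Torus.proj ξ) j) =
      B.indicator (fun ξ => Vol⁻¹ * F ξ) ξ := by
    intro ξ
    set a : EuclideanSpace ℝ d := v (x + FunctionSpaces.Torus.proj ξ) with ha
    by_cases hξ : ξ ∈ B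
    · simp only [novackKernelE₀, ← hBdef, indicator_of_mem hξ]
      have hrow : ∀ i, ∑ j, novackKernelConst d ℓ * ((ℓ ^ 2 - ‖ξ‖ ^ 2) * (if i = j then 1 else 0) + ξ i * ξ j) *
          (a i * a j) = a i * (novackKernelConst d ℓ * ((ℓ ^ 2 - ‖ξ‖ ^ 2) * a i + ξ i * ⟪ξ, a⟫)) := by
        intro i
        have e : ∀ j, novackKernelConst d ℓ * ((ℓ ^ 2 - ‖ξ‖ ^ 2) * (if i = j then 1 else 0) + ξ i * ξ j) *
            (a i * a j) = a i * (novackKernelConst d ℓ * ((ℓ ^ 2 - ‖ξ‖ ^ 2) * (if i = j then 1 else 0) + ξ i * ξ j) * a j) :=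
          fun j => by ring
        rw [Finset.sum_congr rfl fun j _ => e j, ← Finset.mul_sum, sum_sharpRow_mul, ← real_inner_eq_sum_mul]
      rw [Finset.sum_congr rfl fun i _ => hrow i]
      have hsq : ∑ i, a i * (novackKernelConst d ℓ * ((ℓ ^ 2 - ‖ξ‖ ^ 2) * a i + ξ i * ⟪ξ, a⟫)) =
          novackKernelConst d ℓ * ((ℓ ^ 2 - ‖ξ‖ ^ 2) * ‖a‖ ^ 2 + ⟪ξ, a⟫ ^ 2) := by
        have e : ∀ i, a i * (novackKernelConst d ℓ * ((ℓ ^ 2 - ‖ξ‖ ^ 2) * a i + ξ i * ⟪ξ, a⟫)) =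
            novackKernelConst d ℓ * (ℓ ^ 2 - ‖ξ‖ ^ 2) * (a i * a i) +
              novackKernelConst d ℓ * ⟪ξ, a⟫ * (ξ i * a i) := fun i => by ring
        rw [Finset.sum_congr rfl fun i _ => e i, Finset.sum_add_distrib, ← Finset.mul_sum, ← Finset.mul_sum,
          real_inner_eq_sum_mul ξ a, EuclideanSpace.real_norm_sq_eq a]
        have e2 : ∑ i, a i ^ 2 = ∑ i, a i * a i := Finset.sum_congr rfl fun i _ => sq _
        rw [e2]
        ring
      rw [hsq, hcV]
      simp only [hF]
      field_simp
      ring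
    · simp only [novackKernelE₀, ← hBdef, indicator_of_notMem hξ, zero_mul, Finset.sum_const_zero]
  have hR : ∑ i, ∑ j, ∫ ξ, novackKernelE₀ ℓ i j ξ *
        (v (x + FunctionSpaces.Torus.proj ξ) i * v (x + FunctionSpaces.Torus.proj ξ) j) =
      ∫ ξ, B.indicator (fun ξ => Vol⁻¹ * F ξ) ξ := by
    have h1 : ∀ i, ∑ j, ∫ ξ, novackKernelE₀ ℓ i j ξ *
        (v (x + FunctionSpaces.Torus.proj ξ) i * v (x + FunctionSpaces.Torus.proj ξ) j) =
        ∫ ξ, ∑ j, novackKernelE₀ ℓ i j ξ *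
          (v (x + FunctionSpaces.Torus.proj ξ) i * v (x + FunctionSpaces.Torus.proj ξ) j) := fun i =>
      (integral_finsetSum _ fun j _ => hint i j).symm
    rw [Finset.sum_congr rfl fun i _ => h1 i,
      ← integral_finsetSum _ fun i _ => integrable_finsetSum _ fun j _ => hint i j]
    exact integral_congr_ae (ae_of_all _ hpt)
  rw [hR, integral_indicator measurableSet_ball, integral_const_mul, longAvgSq, ← hBdef, setAverage_eq,
    ← hVol, smul_eq_mul]

/-- **The sharp cubic average is Novack's `(u|u_L|²)_ℓ`** ((increments c), `f = uᵏ`): for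
`v ∈ L¹(T^d)` with `|v|³ ∈ L¹(T^d)`, `0 < ℓ`, every `x` and component `k`,
`(uᵏ|u_L|²)_ℓ(x) = ∑ᵢⱼ ∫ M_ℓ^{ij}(ξ) vᵢvⱼvₖ(x + πξ) dξ` (`Torus.longAvgCube`). [cite: Novack2024, Sect. 2 Step 2 (you:ell:ell)] -/
theorem longAvgCube_apply_eq_sum_integral [Nonempty d] (hℓ : 0 < ℓ) (hv : Integrable v volume)
    (hv3 : Integrable (fun y => ‖v y‖ ^ 3) volume) (x : UnitAddTorus d) (k : d) :
    longAvgCube v ℓ x k = ∑ i, ∑ j, ∫ ξ, novackKernelE₀ ℓ i j ξ *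
      (v (x + FunctionSpaces.Torus.proj ξ) i * v (x + FunctionSpaces.Torus.proj ξ) j *
        v (x + FunctionSpaces.Torus.proj ξ) k) := by
  obtain ⟨hB, -⟩ := novackKernelConst_mul_volume_real (d := d) hℓ
  have hcV := novackKernelConst_eq (d := d) ℓ
  set B := ball (0 : EuclideanSpace ℝ d) ℓ with hBdef
  set Vol := (volume : Measure (EuclideanSpace ℝ d)).real B with hVol
  have hℓ2 : ℓ ^ 2 ≠ 0 := by positivity
  set F : EuclideanSpace ℝ d → EuclideanSpace ℝ d := fun ξ =>
    ((1 - ‖ξ‖ ^ 2 / ℓ ^ 2) * ‖v (x + FunctionSpaces.Torus.proj ξ)‖ ^ 2 +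
      (ℓ ^ 2)⁻¹ * ⟪ξ, v (x + FunctionSpaces.Torus.proj ξ)⟫ ^ 2) • v (x + FunctionSpaces.Torus.proj ξ) with hF
  have hv3B : IntegrableOn (fun ξ : EuclideanSpace ℝ d => ‖v (x + FunctionSpaces.Torus.proj ξ)‖ ^ 3) B volume :=
    integrableOn_translate_ball hv3 x ℓ
  have hvmB : AEStronglyMeasurable (fun ξ : EuclideanSpace ℝ d => v (x + FunctionSpaces.Torus.proj ξ))
      (volume.restrict B) := (integrableOn_translate_ball hv x ℓ).aestronglyMeasurable
  have hcoefm : AEStronglyMeasurable (fun ξ : EuclideanSpace ℝ d =>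
      (1 - ‖ξ‖ ^ 2 / ℓ ^ 2) * ‖v (x + FunctionSpaces.Torus.proj ξ)‖ ^ 2 +
        (ℓ ^ 2)⁻¹ * ⟪ξ, v (x + FunctionSpaces.Torus.proj ξ)⟫ ^ 2) (volume.restrict B) :=
    ((continuous_const.sub ((continuous_norm.pow 2).div_const _)).aestronglyMeasurable.mul
      (hvmB.norm.pow 2)).add (((continuous_id.aestronglyMeasurable.inner (𝕜 := ℝ) hvmB).pow 2).const_mul _)
  have hFm : AEStronglyMeasurable F (volume.restrict B) := by
    rw [hF]
    exact hcoefm.smul hvmB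
  have hFint : IntegrableOn F B volume := by
    refine Integrable.mono' (hv3B.const_mul (1 + (ℓ ^ 2)⁻¹ * ℓ ^ 2)) hFm ?_
    filter_upwards [ae_restrict_mem measurableSet_ball] with ξ hξ
    rw [hBdef, mem_ball, dist_zero_right] at hξ
    set a := v (x + FunctionSpaces.Torus.proj ξ) with ha
    obtain ⟨h1, h2, -⟩ := longAvg_coeff_bounds hℓ hξ a
    rw [hF, norm_smul, Real.norm_eq_abs]
    have hA : |(1 - ‖ξ‖ ^ 2 / ℓ ^ 2) * ‖a‖ ^ 2 + (ℓ ^ 2)⁻¹ * ⟪ξ, a⟫ ^ 2| ≤ (1 + (ℓ ^ 2)⁻¹ * ℓ ^ 2) * ‖a‖ ^ 2 := by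
      calc |(1 - ‖ξ‖ ^ 2 / ℓ ^ 2) * ‖a‖ ^ 2 + (ℓ ^ 2)⁻¹ * ⟪ξ, a⟫ ^ 2|
          ≤ |(1 - ‖ξ‖ ^ 2 / ℓ ^ 2) * ‖a‖ ^ 2| + |(ℓ ^ 2)⁻¹ * ⟪ξ, a⟫ ^ 2| := abs_add_le _ _
        _ = |1 - ‖ξ‖ ^ 2 / ℓ ^ 2| * ‖a‖ ^ 2 + (ℓ ^ 2)⁻¹ * ⟪ξ, a⟫ ^ 2 := by
            rw [abs_mul, abs_of_nonneg (sq_nonneg ‖a‖), abs_mul, abs_of_nonneg (inv_nonneg.2 (sq_nonneg ℓ)),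
              abs_of_nonneg (sq_nonneg ⟪ξ, a⟫)]
        _ ≤ 1 * ‖a‖ ^ 2 + (ℓ ^ 2)⁻¹ * (ℓ ^ 2 * ‖a‖ ^ 2) := by gcongr
        _ = (1 + (ℓ ^ 2)⁻¹ * ℓ ^ 2) * ‖a‖ ^ 2 := by ring
    calc |(1 - ‖ξ‖ ^ 2 / ℓ ^ 2) * ‖a‖ ^ 2 + (ℓ ^ 2)⁻¹ * ⟪ξ, a⟫ ^ 2| * ‖a‖
        ≤ (1 + (ℓ ^ 2)⁻¹ * ℓ ^ 2) * ‖a‖ ^ 2 * ‖a‖ := by gcongr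
      _ = (1 + (ℓ ^ 2)⁻¹ * ℓ ^ 2) * ‖a‖ ^ 3 := by ring
  -- products `vᵢvⱼvₖ` are integrable
  have hvmeas : ∀ j, AEStronglyMeasurable (fun y => v y j) volume := fun j =>
    (EuclideanSpace.proj (𝕜 := ℝ) j).continuous.comp_aestronglyMeasurable hv.aestronglyMeasurable
  have hvijk : ∀ i j, Integrable (fun y => v y i * v y j * v y k) volume := fun i j => by
    refine hv3.mono' (((hvmeas i).mul (hvmeas j)).mul (hvmeas k)) (ae_of_all _ fun y => ?_)
    rw [norm_mul, norm_mul]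
    calc ‖v y i‖ * ‖v y j‖ * ‖v y k‖ ≤ ‖v y‖ * ‖v y‖ * ‖v y‖ := by
          gcongr <;> exact PiLp.norm_apply_le _ _
      _ = ‖v y‖ ^ 3 := by ring
  have hint : ∀ i j, Integrable (fun ξ => novackKernelE₀ ℓ i j ξ *
      (v (x + FunctionSpaces.Torus.proj ξ) i * v (x + FunctionSpaces.Torus.proj ξ) j *
        v (x + FunctionSpaces.Torus.proj ξ) k)) volume := fun i j => by
    simpa only [smul_eq_mul] using integrable_kernel_smul_translate
      (measurable_novackKernelE₀ ℓ i j).aestronglyMeasurable (abs_novackKernelE₀_le i j)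
      (support_novackKernelE₀_subset ℓ i j) (hvijk i j) x
  have hL : longAvgCube v ℓ x k = Vol⁻¹ * ∫ ξ in B, F ξ k := by
    rw [longAvgCube, ← hBdef, setAverage_eq, ← hVol]
    change (EuclideanSpace.proj k : EuclideanSpace ℝ d →L[ℝ] ℝ) (Vol⁻¹ • ∫ ξ in B, F ξ) = _
    rw [map_smul, smul_eq_mul, ← (EuclideanSpace.proj k : EuclideanSpace ℝ d →L[ℝ] ℝ).integral_comp_comm hFint]
    rfl
  have hpt : ∀ ξ, ∑ i, ∑ j, novackKernelE₀ ℓ i j ξ *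
        (v (x + FunctionSpaces.Torus.proj ξ) i * v (x + FunctionSpaces.Torus.proj ξ) j *
          v (x + FunctionSpaces.Torus.proj ξ) k) =
      B.indicator (fun ξ => Vol⁻¹ * F ξ k) ξ := by
    intro ξ
    set a : EuclideanSpace ℝ d := v (x + FunctionSpaces.Torus.proj ξ) with ha
    by_cases hξ : ξ ∈ B
    · simp only [novackKernelE₀, ← hBdef, indicator_of_mem hξ]
      have hrow : ∀ i, ∑ j, novackKernelConst d ℓ * ((ℓ ^ 2 - ‖ξ‖ ^ 2) * (if i = j then 1 else 0) + ξ i * ξ j) *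
          (a i * a j * a k) = a i * a k * (novackKernelConst d ℓ * ((ℓ ^ 2 - ‖ξ‖ ^ 2) * a i + ξ i * ⟪ξ, a⟫)) := by
        intro i
        have e : ∀ j, novackKernelConst d ℓ * ((ℓ ^ 2 - ‖ξ‖ ^ 2) * (if i = j then 1 else 0) + ξ i * ξ j) *
            (a i * a j * a k) =
            a i * a k * (novackKernelConst d ℓ * ((ℓ ^ 2 - ‖ξ‖ ^ 2) * (if i = j then 1 else 0) + ξ i * ξ j) * a j) :=
          fun j => by ring
        rw [Finset.sum_congr rfl fun j _ => e j, ← Finset.mul_sum, sum_sharpRow_mul, ← real_inner_eq_sum_mul]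
      rw [Finset.sum_congr rfl fun i _ => hrow i]
      have hsq : ∑ i, a i * a k * (novackKernelConst d ℓ * ((ℓ ^ 2 - ‖ξ‖ ^ 2) * a i + ξ i * ⟪ξ, a⟫)) =
          novackKernelConst d ℓ * ((ℓ ^ 2 - ‖ξ‖ ^ 2) * ‖a‖ ^ 2 + ⟪ξ, a⟫ ^ 2) * a k := by
        have e : ∀ i, a i * a k * (novackKernelConst d ℓ * ((ℓ ^ 2 - ‖ξ‖ ^ 2) * a i + ξ i * ⟪ξ, a⟫)) =
            novackKernelConst d ℓ * (ℓ ^ 2 - ‖ξ‖ ^ 2) * a k * (a i * a i) +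
              novackKernelConst d ℓ * ⟪ξ, a⟫ * a k * (ξ i * a i) := fun i => by ring
        rw [Finset.sum_congr rfl fun i _ => e i, Finset.sum_add_distrib, ← Finset.mul_sum, ← Finset.mul_sum,
          real_inner_eq_sum_mul ξ a, EuclideanSpace.real_norm_sq_eq a]
        have e2 : ∑ i, a i ^ 2 = ∑ i, a i * a i := Finset.sum_congr rfl fun i _ => sq _
        rw [e2]
        ring
      rw [hsq, hcV]
      simp only [hF, PiLp.smul_apply, smul_eq_mul]
      field_simp
      ring
    · simp only [novackKernelE₀, ← hBdef, indicator_of_notMem hξ, zero_mul, Finset.sum_const_zero]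
  have hR : ∑ i, ∑ j, ∫ ξ, novackKernelE₀ ℓ i j ξ *
        (v (x + FunctionSpaces.Torus.proj ξ) i * v (x + FunctionSpaces.Torus.proj ξ) j *
          v (x + FunctionSpaces.Torus.proj ξ) k) =
      ∫ ξ, B.indicator (fun ξ => Vol⁻¹ * F ξ k) ξ := by
    have h1 : ∀ i, ∑ j, ∫ ξ, novackKernelE₀ ℓ i j ξ *
        (v (x + FunctionSpaces.Torus.proj ξ) i * v (x + FunctionSpaces.Torus.proj ξ) j *
          v (x + FunctionSpaces.Torus.proj ξ) k) =
        ∫ ξ, ∑ j, novackKernelE₀ ℓ i j ξ *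
          (v (x + FunctionSpaces.Torus.proj ξ) i * v (x + FunctionSpaces.Torus.proj ξ) j *
            v (x + FunctionSpaces.Torus.proj ξ) k) := fun i => (integral_finsetSum _ fun j _ => hint i j).symm
    rw [Finset.sum_congr rfl fun i _ => h1 i,
      ← integral_finsetSum _ fun i _ => integrable_finsetSum _ fun j _ => hint i j]
    exact integral_congr_ae (ae_of_all _ hpt)
  rw [hL, hR, integral_indicator measurableSet_ball, integral_const_mul]

omit [DecidableEq d] in
/-- **The sharp potential average is Novack's `p_{L,ℓ}`** ("defined analogously"): for
`q ∈ L¹(T^d)`, `0 < ℓ` and every `x`, `p_{L,ℓ}(x) = ∫ ζ̃_ℓ(ξ) q(x + πξ) dξ`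
(`Torus.longAvgPressure`). [cite: Novack2024, Sect. 2 Step 2, potentials ζ̃ and (you:ell:ell)] -/
theorem longAvgPressure_eq_integral [DecidableEq d] [Nonempty d] (hℓ : 0 < ℓ) (x : UnitAddTorus d) :
    longAvgPressure d q ℓ x = ∫ ξ, novackPotentialE₀ d ℓ ξ * q (x + FunctionSpaces.Torus.proj ξ) := by
  obtain ⟨hB, -⟩ := novackKernelConst_mul_volume_real (d := d) hℓ
  have hcV := novackKernelConst_eq (d := d) ℓ
  set B := ball (0 : EuclideanSpace ℝ d) ℓ with hBdef
  set Vol := (volume : Measure (EuclideanSpace ℝ d)).real B with hVol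
  have hℓ2 : ℓ ^ 2 ≠ 0 := by positivity
  set F : EuclideanSpace ℝ d → ℝ := fun ξ =>
    (1 - ((Fintype.card d : ℝ) - 1) / 2 * (1 - ‖ξ‖ ^ 2 / ℓ ^ 2)) * q (x + FunctionSpaces.Torus.proj ξ) with hF
  have hpt : ∀ ξ, novackPotentialE₀ d ℓ ξ * q (x + FunctionSpaces.Torus.proj ξ) =
      B.indicator (fun ξ => Vol⁻¹ * F ξ) ξ := by
    intro ξ
    by_cases hξ : ξ ∈ B
    · simp only [novackPotentialE₀, ← hBdef, indicator_of_mem hξ, hF, hcV]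
      field_simp
      ring
    · simp only [novackPotentialE₀, ← hBdef, indicator_of_notMem hξ, zero_mul]
  rw [integral_congr_ae (ae_of_all _ hpt), integral_indicator measurableSet_ball, integral_const_mul,
    longAvgPressure, ← hBdef, setAverage_eq, ← hVol, smul_eq_mul]

end Identification

/-! ## The entries and the potential as kernel families along `γ → 0⁺` -/

section Families

variable {T ℓ : ℝ}

/-- The entry family extended by `0` for `γ ≤ 0` (so that the uniform kernel hypotheses of the
master limit lemmas hold for every real `γ`; along `𝓝[>] 0` it is `novackKernelE ℓ γ i j`). [folklore] -/
def entryFamily (ℓ : ℝ) (i j : d) (γ : ℝ) : EuclideanSpace ℝ d → ℝ :=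
  if 0 < γ then novackKernelE ℓ γ i j else 0

variable (d) in
/-- The potential family extended by `0` for `γ ≤ 0`. [folklore] -/
def potentialFamily (ℓ : ℝ) (γ : ℝ) : EuclideanSpace ℝ d → ℝ :=
  if 0 < γ then novackPotentialE d ℓ γ else 0

/-- Along `γ > 0` the entry family is the combined kernel entry. [folklore] -/
theorem entryFamily_of_pos {γ : ℝ} (hγ : 0 < γ) (i j : d) : entryFamily ℓ i j γ = novackKernelE ℓ γ i j := by
  simp [entryFamily, hγ]

omit [DecidableEq d] in
/-- Along `γ > 0` the potential family is the potential. [folklore] -/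
theorem potentialFamily_of_pos {γ : ℝ} (hγ : 0 < γ) : potentialFamily d ℓ γ = novackPotentialE d ℓ γ := by
  simp [potentialFamily, hγ]

/-- Uniform kernel hypotheses for the entry family. [folklore] -/
theorem entryFamily_facts (hℓ : 0 < ℓ) (i j : d) :
    (∀ γ, AEStronglyMeasurable (entryFamily ℓ i j γ) (volume : Measure (EuclideanSpace ℝ d))) ∧
      (∀ γ ξ, ‖entryFamily ℓ i j γ ξ‖ ≤ 2 * novackKernelConst d ℓ * ℓ ^ 2) ∧
      (∀ γ, support (entryFamily ℓ i j γ) ⊆ closedBall 0 ℓ) ∧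
      Tendsto (fun γ => ∫⁻ ξ, ‖entryFamily ℓ i j γ ξ - novackKernelE₀ ℓ i j ξ‖ₑ) (𝓝[>] 0) (𝓝 0) := by
  have hC : 0 ≤ 2 * novackKernelConst d ℓ * ℓ ^ 2 := by
    have := novackKernelConst_nonneg (d := d) ℓ; positivity
  refine ⟨fun γ => ?_, fun γ ξ => ?_, fun γ => ?_, ?_⟩
  · by_cases hγ : 0 < γ
    · rw [entryFamily_of_pos hγ]; exact (contDiff_novackKernelE ℓ γ i j).continuous.aestronglyMeasurable
    · simp only [entryFamily, if_neg hγ]; exact aestronglyMeasurable_const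
  · by_cases hγ : 0 < γ
    · rw [entryFamily_of_pos hγ]; exact abs_novackKernelE_le hℓ hγ i j ξ
    · simp only [entryFamily, if_neg hγ, Pi.zero_apply, norm_zero]; exact hC
  · by_cases hγ : 0 < γ
    · rw [entryFamily_of_pos hγ]
      exact (subset_tsupport _).trans (tsupport_novackKernelE_subset hℓ hγ i j)
    · simp only [entryFamily, if_neg hγ, Function.support_zero]; exact empty_subset _
  · refine (tendsto_lintegral_novackKernelE_sub hℓ i j).congr' ?_
    filter_upwards [self_mem_nhdsWithin] with γ hγ
    rw [entryFamily_of_pos hγ]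

/-- Uniform kernel hypotheses for the potential family. [folklore] -/
theorem potentialFamily_facts (hℓ : 0 < ℓ) :
    (∀ γ, AEStronglyMeasurable (potentialFamily d ℓ γ) (volume : Measure (EuclideanSpace ℝ d))) ∧
      (∀ γ ξ, ‖potentialFamily d ℓ γ ξ‖ ≤
        novackKernelConst d ℓ * ℓ ^ 2 * (1 + |((Fintype.card d : ℝ) - 3) / 2|)) ∧
      (∀ γ, support (potentialFamily d ℓ γ) ⊆ closedBall 0 ℓ) ∧
      Tendsto (fun γ => ∫⁻ ξ, ‖potentialFamily d ℓ γ ξ - novackPotentialE₀ d ℓ ξ‖ₑ) (𝓝[>] 0) (𝓝 0) := by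
  have hC : 0 ≤ novackKernelConst d ℓ * ℓ ^ 2 * (1 + |((Fintype.card d : ℝ) - 3) / 2|) := by
    have := novackKernelConst_nonneg (d := d) ℓ; positivity
  refine ⟨fun γ => ?_, fun γ ξ => ?_, fun γ => ?_, ?_⟩
  · by_cases hγ : 0 < γ
    · rw [potentialFamily_of_pos hγ]; exact (contDiff_novackPotentialE (d := d) ℓ γ).continuous.aestronglyMeasurable
    · simp only [potentialFamily, if_neg hγ]; exact aestronglyMeasurable_const
  · by_cases hγ : 0 < γ
    · rw [potentialFamily_of_pos hγ]; exact abs_novackPotentialE_le hℓ hγ ξ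
    · simp only [potentialFamily, if_neg hγ, Pi.zero_apply, norm_zero]; exact hC
  · by_cases hγ : 0 < γ
    · rw [potentialFamily_of_pos hγ]
      exact (subset_tsupport _).trans (tsupport_novackPotentialE_subset hℓ hγ)
    · simp only [potentialFamily, if_neg hγ, Function.support_zero]; exact empty_subset _
  · refine (tendsto_lintegral_novackPotentialE_sub (d := d) hℓ).congr' ?_
    filter_upwards [self_mem_nhdsWithin] with γ hγ
    rw [potentialFamily_of_pos hγ]

/-- **Entry averages converge, conjugate weight**: the master limit lemma for the kernels
`M_{ℓ,γ}^{ij} → M_ℓ^{ij}` along `γ → 0⁺`. [folklore] -/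
theorem tendsto_entryAverage_of_conj (hℓ : 0 < ℓ) (i j : d) {f : ℝ → UnitAddTorus d → ℝ}
    (hf : AEStronglyMeasurable (uncurry f) ((volume.restrict (Ioo 0 T)).prod volume))
    (hfi : ∀ᵐ t ∂(volume.restrict (Ioo 0 T)), Integrable (f t) volume)
    {a b : ℝ} (hab : a.HolderConjugate b)
    (hfb : ∫⁻ z, ‖uncurry f z‖ₑ ^ b ∂((volume.restrict (Ioo 0 T)).prod volume) < ⊤)
    {w : ℝ × UnitAddTorus d → ℝ} (hw : AEStronglyMeasurable w ((volume.restrict (Ioo 0 T)).prod volume))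
    (hwa : ∫⁻ z, ‖w z‖ₑ ^ a ∂((volume.restrict (Ioo 0 T)).prod volume) < ⊤) :
    Integrable (fun z => w z * ∫ ξ, novackKernelE₀ ℓ i j ξ * f z.1 (z.2 + FunctionSpaces.Torus.proj ξ))
        ((volume.restrict (Ioo 0 T)).prod volume) ∧
      (∀ᶠ γ in 𝓝[>] (0 : ℝ), Integrable (fun z => w z * ∫ ξ, novackKernelE ℓ γ i j ξ * f z.1 (z.2 + FunctionSpaces.Torus.proj ξ))
        ((volume.restrict (Ioo 0 T)).prod volume)) ∧
      Tendsto (fun γ => ∫ z, w z * (∫ ξ, novackKernelE ℓ γ i j ξ * f z.1 (z.2 + FunctionSpaces.Torus.proj ξ))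
          ∂((volume.restrict (Ioo 0 T)).prod volume)) (𝓝[>] 0)
        (𝓝 (∫ z, w z * (∫ ξ, novackKernelE₀ ℓ i j ξ * f z.1 (z.2 + FunctionSpaces.Torus.proj ξ))
          ∂((volume.restrict (Ioo 0 T)).prod volume))) := by
  obtain ⟨hm, hb, hs, hlim⟩ := entryFamily_facts (d := d) hℓ i j
  obtain ⟨hI₀, hI, hT⟩ := tendsto_integral_mul_kernelAverage_of_conj (T := T) (l := 𝓝[>] (0 : ℝ)) hm
    (measurable_novackKernelE₀ ℓ i j).aestronglyMeasurable hb (abs_novackKernelE₀_le i j) hs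
    (support_novackKernelE₀_subset ℓ i j) hlim hf hfi hab hfb hw hwa
  refine ⟨hI₀, ?_, hT.congr' ?_⟩
  · filter_upwards [self_mem_nhdsWithin] with γ hγ
    simpa only [entryFamily_of_pos hγ] using hI γ
  · filter_upwards [self_mem_nhdsWithin] with γ hγ
    simp only [entryFamily_of_pos hγ]

/-- **Entry averages converge, bounded weight**. [folklore] -/
theorem tendsto_entryAverage_of_bound (hℓ : 0 < ℓ) (i j : d) {f : ℝ → UnitAddTorus d → ℝ}
    (hf : AEStronglyMeasurable (uncurry f) ((volume.restrict (Ioo 0 T)).prod volume))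
    (hfi : ∀ᵐ t ∂(volume.restrict (Ioo 0 T)), Integrable (f t) volume)
    (hf1 : ∫⁻ z, ‖uncurry f z‖ₑ ∂((volume.restrict (Ioo 0 T)).prod volume) < ⊤)
    {w : ℝ × UnitAddTorus d → ℝ} (hw : AEStronglyMeasurable w ((volume.restrict (Ioo 0 T)).prod volume))
    {Cw : ℝ} (hwb : ∀ z, ‖w z‖ ≤ Cw) :
    Integrable (fun z => w z * ∫ ξ, novackKernelE₀ ℓ i j ξ * f z.1 (z.2 + FunctionSpaces.Torus.proj ξ))
        ((volume.restrict (Ioo 0 T)).prod volume) ∧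
      (∀ᶠ γ in 𝓝[>] (0 : ℝ), Integrable (fun z => w z * ∫ ξ, novackKernelE ℓ γ i j ξ * f z.1 (z.2 + FunctionSpaces.Torus.proj ξ))
        ((volume.restrict (Ioo 0 T)).prod volume)) ∧
      Tendsto (fun γ => ∫ z, w z * (∫ ξ, novackKernelE ℓ γ i j ξ * f z.1 (z.2 + FunctionSpaces.Torus.proj ξ))
          ∂((volume.restrict (Ioo 0 T)).prod volume)) (𝓝[>] 0)
        (𝓝 (∫ z, w z * (∫ ξ, novackKernelE₀ ℓ i j ξ * f z.1 (z.2 + FunctionSpaces.Torus.proj ξ))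
          ∂((volume.restrict (Ioo 0 T)).prod volume))) := by
  obtain ⟨hm, hb, hs, hlim⟩ := entryFamily_facts (d := d) hℓ i j
  obtain ⟨hI₀, hI, hT⟩ := tendsto_integral_mul_kernelAverage_of_bound (T := T) (l := 𝓝[>] (0 : ℝ)) hm
    (measurable_novackKernelE₀ ℓ i j).aestronglyMeasurable hb (abs_novackKernelE₀_le i j) hs
    (support_novackKernelE₀_subset ℓ i j) hlim hf hfi hf1 hw hwb
  refine ⟨hI₀, ?_, hT.congr' ?_⟩
  · filter_upwards [self_mem_nhdsWithin] with γ hγ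
    simpa only [entryFamily_of_pos hγ] using hI γ
  · filter_upwards [self_mem_nhdsWithin] with γ hγ
    simp only [entryFamily_of_pos hγ]

/-- **Potential averages converge, conjugate weight**: the master limit lemma for
`ζ̃_{ℓ,γ} → ζ̃_ℓ` along `γ → 0⁺`. [folklore] -/
theorem tendsto_potentialAverage_of_conj (hℓ : 0 < ℓ) {f : ℝ → UnitAddTorus d → ℝ}
    (hf : AEStronglyMeasurable (uncurry f) ((volume.restrict (Ioo 0 T)).prod volume))
    (hfi : ∀ᵐ t ∂(volume.restrict (Ioo 0 T)), Integrable (f t) volume)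
    {a b : ℝ} (hab : a.HolderConjugate b)
    (hfb : ∫⁻ z, ‖uncurry f z‖ₑ ^ b ∂((volume.restrict (Ioo 0 T)).prod volume) < ⊤)
    {w : ℝ × UnitAddTorus d → ℝ} (hw : AEStronglyMeasurable w ((volume.restrict (Ioo 0 T)).prod volume))
    (hwa : ∫⁻ z, ‖w z‖ₑ ^ a ∂((volume.restrict (Ioo 0 T)).prod volume) < ⊤) :
    Integrable (fun z => w z * ∫ ξ, novackPotentialE₀ d ℓ ξ * f z.1 (z.2 + FunctionSpaces.Torus.proj ξ))
        ((volume.restrict (Ioo 0 T)).prod volume) ∧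
      (∀ᶠ γ in 𝓝[>] (0 : ℝ), Integrable (fun z => w z * ∫ ξ, novackPotentialE d ℓ γ ξ * f z.1 (z.2 + FunctionSpaces.Torus.proj ξ))
        ((volume.restrict (Ioo 0 T)).prod volume)) ∧
      Tendsto (fun γ => ∫ z, w z * (∫ ξ, novackPotentialE d ℓ γ ξ * f z.1 (z.2 + FunctionSpaces.Torus.proj ξ))
          ∂((volume.restrict (Ioo 0 T)).prod volume)) (𝓝[>] 0)
        (𝓝 (∫ z, w z * (∫ ξ, novackPotentialE₀ d ℓ ξ * f z.1 (z.2 + FunctionSpaces.Torus.proj ξ))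
          ∂((volume.restrict (Ioo 0 T)).prod volume))) := by
  obtain ⟨hm, hb, hs, hlim⟩ := potentialFamily_facts (d := d) (ℓ := ℓ) hℓ
  obtain ⟨hI₀, hI, hT⟩ := tendsto_integral_mul_kernelAverage_of_conj (T := T) (l := 𝓝[>] (0 : ℝ)) hm
    (measurable_novackPotentialE₀ (d := d) ℓ).aestronglyMeasurable hb (abs_novackPotentialE₀_le (d := d))
    hs (support_novackPotentialE₀_subset (d := d) ℓ) hlim hf hfi hab hfb hw hwa
  refine ⟨hI₀, ?_, hT.congr' ?_⟩
  · filter_upwards [self_mem_nhdsWithin] with γ hγ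
    simpa only [potentialFamily_of_pos hγ] using hI γ
  · filter_upwards [self_mem_nhdsWithin] with γ hγ
    simp only [potentialFamily_of_pos hγ]

end Families

/-! ## Exponent bookkeeping on the finite measure space `(0,T) × T^d` -/

section Exponents

variable {X : Type*} [MeasurableSpace X] {μ : Measure X} [IsFiniteMeasure μ]

omit [IsFiniteMeasure μ] in
/-- `a^{3/2} ≤ 1 + a³` in `ℝ≥0∞`. [folklore] -/
theorem _root_.ENNReal.rpow_threeHalves_le_one_add_pow_three (a : ℝ≥0∞) :
    a ^ (3 / 2 : ℝ) ≤ 1 + a ^ (3 : ℝ) := by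
  rcases le_total a 1 with h | h
  · exact (ENNReal.rpow_le_one h (by norm_num)).trans (le_add_of_nonneg_right zero_le)
  · exact (ENNReal.rpow_le_rpow_of_exponent_le h (by norm_num : (3 / 2 : ℝ) ≤ 3)).trans
      (le_add_of_nonneg_left zero_le)

/-- **`L³ ⊂ L^{3/2}` on a finite measure space**, lower-integral form. [folklore] -/
theorem lintegral_rpow_threeHalves_lt_top_of_three {f : X → ℝ≥0∞} (hf : AEMeasurable f μ)
    (h3 : ∫⁻ x, f x ^ (3 : ℝ) ∂μ < ⊤) : ∫⁻ x, f x ^ (3 / 2 : ℝ) ∂μ < ⊤ := by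
  calc ∫⁻ x, f x ^ (3 / 2 : ℝ) ∂μ ≤ ∫⁻ x, 1 + f x ^ (3 : ℝ) ∂μ :=
        lintegral_mono fun x => ENNReal.rpow_threeHalves_le_one_add_pow_three _
    _ = μ univ + ∫⁻ x, f x ^ (3 : ℝ) ∂μ := by
        rw [lintegral_add_right' _ (hf.pow_const _), lintegral_one]
    _ < ⊤ := ENNReal.add_lt_top.2 ⟨measure_lt_top _ _, h3⟩

end Exponents

/-! ## The six pairings: preparation -/

section Assembly

variable {T : ℝ} {u : ℝ → UnitAddTorus d → EuclideanSpace ℝ d} {p : ℝ → UnitAddTorus d → ℝ}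
  {ψ : ℝ → UnitAddTorus d → ℝ} {ℓ : ℝ}

/-- Hölder conjugacy of `3/2` and `3`. [folklore] -/
theorem holderConjugate_threeHalves_three : (3 / 2 : ℝ).HolderConjugate 3 :=
  Real.holderConjugate_iff.2 ⟨by norm_num, by norm_num⟩

/-- Pointwise domination propagates `L^r` finiteness: `|f| ≤ C |g|`, `∫|g|^r < ∞ ⇒ ∫ |f|^r < ∞`. [folklore] -/
theorem lintegral_rpow_lt_top_of_norm_le {X : Type*} [MeasurableSpace X] {μ : Measure X}
    {E E' : Type*} [NormedAddCommGroup E] [NormedAddCommGroup E'] {f : X → E} {g : X → E'} {C : ℝ}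
    (hC : 0 ≤ C) (h : ∀ᵐ x ∂μ, ‖f x‖ ≤ C * ‖g x‖) {r : ℝ} (hr : 0 ≤ r)
    (hg : ∫⁻ x, ‖g x‖ₑ ^ r ∂μ < ⊤) : ∫⁻ x, ‖f x‖ₑ ^ r ∂μ < ⊤ :=
  lt_of_le_of_lt (lintegral_rpow_enorm_le_of_norm_le hC h hr)
    (ENNReal.mul_lt_top (ENNReal.rpow_lt_top_of_nonneg hr ENNReal.ofReal_ne_top) hg)

/-- **The matrix-mollified velocity at a.e. space–time point**, componentwise, as entry
averages: for `0 < γ`, a.e. on `(0,T) × T^d`,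
`(u_{M_{ℓ,γ}})ᵢ(t,x) = ∑ⱼ ∫ M_{ℓ,γ}^{ij}(ξ) uⱼ(t, x + πξ) dξ`. [folklore] -/
theorem ae_matConv_novackKernel_apply (hℓ : 0 < ℓ) {γ : ℝ} (hγ : 0 < γ)
    (hsl : ∀ᵐ t ∂(volume.restrict (Ioo 0 T)), Integrable (u t) volume) :
    ∀ᵐ z ∂((volume.restrict (Ioo 0 T)).prod (volume : Measure (UnitAddTorus d))), ∀ i,
      matConv (u z.1) (novackKernel ℓ γ) z.2 i =
        ∑ j, ∫ ξ, novackKernelE ℓ γ i j ξ * u z.1 (z.2 + FunctionSpaces.Torus.proj ξ) j := by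
  filter_upwards [(quasiMeasurePreserving_fst (μ := volume.restrict (Ioo 0 T))
    (ν := (volume : Measure (UnitAddTorus d)))).ae hsl] with z hz i
  rw [matConv_apply]
  refine Finset.sum_congr rfl fun j _ => ?_
  rw [novackKernel]
  exact convolution_periodize_apply (contDiff_novackKernelE ℓ γ i j).continuous
    (tsupport_novackKernelE_subset hℓ hγ i j) (novackKernelE_neg ℓ γ i j) (hz.eval_piLp j) z.2

/-- **The quadratic matrix average at a.e. point** as entry averages of `uᵢuⱼ`. [folklore] -/
theorem ae_matConvSq_novackKernel (hℓ : 0 < ℓ) {γ : ℝ} (hγ : 0 < γ)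
    (hsl : ∀ᵐ t ∂(volume.restrict (Ioo 0 T)), MemLp (u t) 3 volume) :
    ∀ᵐ z ∂((volume.restrict (Ioo 0 T)).prod (volume : Measure (UnitAddTorus d))),
      matConvSq (u z.1) (novackKernel ℓ γ) z.2 =
        ∑ i, ∑ j, ∫ ξ, novackKernelE ℓ γ i j ξ *
          (u z.1 (z.2 + FunctionSpaces.Torus.proj ξ) i * u z.1 (z.2 + FunctionSpaces.Torus.proj ξ) j) := by
  filter_upwards [(quasiMeasurePreserving_fst (μ := volume.restrict (Ioo 0 T))
    (ν := (volume : Measure (UnitAddTorus d)))).ae hsl] with z hz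
  obtain ⟨-, I2, -⟩ := MemLp.integrable_norm_pow_three_and_sq hz
  rw [matConvSq]
  refine Finset.sum_congr rfl fun i _ => Finset.sum_congr rfl fun j _ => ?_
  rw [novackKernel]
  exact convolution_periodize_apply (contDiff_novackKernelE ℓ γ i j).continuous
    (tsupport_novackKernelE_subset hℓ hγ i j) (novackKernelE_neg ℓ γ i j)
    (integrable_apply_mul_apply hz.1 I2 i j) z.2

/-- **The cubic matrix average at a.e. point** as entry averages of `uᵢuⱼuₖ`. [folklore] -/
theorem ae_matConvCube_novackKernel_apply (hℓ : 0 < ℓ) {γ : ℝ} (hγ : 0 < γ)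
    (hsl : ∀ᵐ t ∂(volume.restrict (Ioo 0 T)), MemLp (u t) 3 volume) :
    ∀ᵐ z ∂((volume.restrict (Ioo 0 T)).prod (volume : Measure (UnitAddTorus d))), ∀ k,
      matConvCube (u z.1) (novackKernel ℓ γ) z.2 k =
        ∑ i, ∑ j, ∫ ξ, novackKernelE ℓ γ i j ξ *
          (u z.1 (z.2 + FunctionSpaces.Torus.proj ξ) i * u z.1 (z.2 + FunctionSpaces.Torus.proj ξ) j *
            u z.1 (z.2 + FunctionSpaces.Torus.proj ξ) k) := by
  filter_upwards [(quasiMeasurePreserving_fst (μ := volume.restrict (Ioo 0 T))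
    (ν := (volume : Measure (UnitAddTorus d)))).ae hsl] with z hz k
  obtain ⟨I3, -, -⟩ := MemLp.integrable_norm_pow_three_and_sq hz
  have hvmeas : ∀ j, AEStronglyMeasurable (fun y => u z.1 y j) volume := fun j =>
    (EuclideanSpace.proj (𝕜 := ℝ) j).continuous.comp_aestronglyMeasurable hz.1
  have hijk : ∀ i j, Integrable (fun y => u z.1 y i * u z.1 y j * u z.1 y k) volume := fun i j => by
    refine I3.mono' (((hvmeas i).mul (hvmeas j)).mul (hvmeas k)) (ae_of_all _ fun y => ?_)
    rw [norm_mul, norm_mul]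
    calc ‖u z.1 y i‖ * ‖u z.1 y j‖ * ‖u z.1 y k‖ ≤ ‖u z.1 y‖ * ‖u z.1 y‖ * ‖u z.1 y‖ := by
          gcongr <;> exact PiLp.norm_apply_le _ _
      _ = ‖u z.1 y‖ ^ 3 := by ring
  rw [matConvCube_apply]
  refine Finset.sum_congr rfl fun i _ => Finset.sum_congr rfl fun j _ => ?_
  rw [novackKernel]
  exact convolution_periodize_apply (contDiff_novackKernelE ℓ γ i j).continuous
    (tsupport_novackKernelE_subset hℓ hγ i j) (novackKernelE_neg ℓ γ i j) (hijk i j) z.2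

omit [DecidableEq d] in
/-- **The potential-mollified pressure at a.e. point** as a potential average. [folklore] -/
theorem ae_convolution_novackPotential [DecidableEq d] (hℓ : 0 < ℓ) {γ : ℝ} (hγ : 0 < γ)
    (hslp : ∀ᵐ t ∂(volume.restrict (Ioo 0 T)), Integrable (p t) volume) :
    ∀ᵐ z ∂((volume.restrict (Ioo 0 T)).prod (volume : Measure (UnitAddTorus d))),
      (p z.1 ⋆ novackPotential d ℓ γ) z.2 =
        ∫ ξ, novackPotentialE d ℓ γ ξ * p z.1 (z.2 + FunctionSpaces.Torus.proj ξ) := by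
  filter_upwards [(quasiMeasurePreserving_fst (μ := volume.restrict (Ioo 0 T))
    (ν := (volume : Measure (UnitAddTorus d)))).ae hslp] with z hz
  rw [novackPotential]
  exact convolution_periodize_apply (contDiff_novackPotentialE (d := d) ℓ γ).continuous
    (tsupport_novackPotentialE_subset hℓ hγ) (novackPotentialE_neg ℓ γ) hz z.2

omit [DecidableEq d] in
/-- Components of an `L³` field are in `L³`. [folklore] -/
theorem lintegral_apply_rpow_three_lt_top
    (hU3 : ∫⁻ z, ‖u z.1 z.2‖ₑ ^ (3 : ℝ) ∂((volume.restrict (Ioo 0 T)).prod (volume : Measure (UnitAddTorus d))) < ⊤)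
    (j : d) :
    ∫⁻ z, ‖uncurry (fun t x => u t x j) z‖ₑ ^ (3 : ℝ) ∂((volume.restrict (Ioo 0 T)).prod (volume : Measure (UnitAddTorus d))) < ⊤ := by
  refine lt_of_le_of_lt (lintegral_mono fun z => ENNReal.rpow_le_rpow ?_ (by norm_num)) hU3
  rw [← ofReal_norm, ← ofReal_norm]
  exact ENNReal.ofReal_le_ofReal (PiLp.norm_apply_le (u z.1 z.2) j)

omit [DecidableEq d] in
/-- A.e. slices of an `L³` velocity are integrable. [folklore] -/
theorem ae_integrable_slice_of_memLp
    (hsl : ∀ᵐ t ∂(volume.restrict (Ioo 0 T)), MemLp (u t) 3 (volume : Measure (UnitAddTorus d))) :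
    ∀ᵐ t ∂(volume.restrict (Ioo 0 T)), Integrable (u t) volume :=
  hsl.mono fun _ ht => (MemLp.integrable_norm_pow_three_and_sq ht).2.2

/-- **Type I pairings converge** (terms `A`, `B`, `E` of the balance: weights `wᵢ ∈ L^{3/2}`
against the components of the matrix-mollified velocity): as `γ → 0⁺`,
`∫₀ᵀ∫ ∑ᵢ wᵢ (u_{M_{ℓ,γ}})ᵢ → ∫₀ᵀ∫ ∑ᵢ wᵢ (u_{L,ℓ})ᵢ`. [cite: Novack2024, Sect. 2 Step 2, limit γ → 0 (dominated convergence)] -/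
theorem tendsto_integral_sum_mul_matConv [Nonempty d] (hℓ : 0 < ℓ)
    (hum : AEStronglyMeasurable (uncurry u) ((volume.restrict (Ioo 0 T)).prod volume))
    (hU3 : ∫⁻ z, ‖u z.1 z.2‖ₑ ^ (3 : ℝ) ∂((volume.restrict (Ioo 0 T)).prod (volume : Measure (UnitAddTorus d))) < ⊤)
    (hsl : ∀ᵐ t ∂(volume.restrict (Ioo 0 T)), MemLp (u t) 3 (volume : Measure (UnitAddTorus d)))
    {w : d → ℝ × UnitAddTorus d → ℝ} (hw : ∀ i, AEStronglyMeasurable (w i) ((volume.restrict (Ioo 0 T)).prod volume))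
    (hwa : ∀ i, ∫⁻ z, ‖w i z‖ₑ ^ (3 / 2 : ℝ) ∂((volume.restrict (Ioo 0 T)).prod (volume : Measure (UnitAddTorus d))) < ⊤) :
    Tendsto (fun γ => ∫ t in Ioo 0 T, ∫ x, ∑ i, w i (t, x) * matConv (u t) (novackKernel ℓ γ) x i)
      (𝓝[>] 0) (𝓝 (∫ t in Ioo 0 T, ∫ x, ∑ i, w i (t, x) * longAvg (u t) ℓ x i)) := by
  set μT := (volume.restrict (Ioo 0 T)).prod (volume : Measure (UnitAddTorus d)) with hμT
  have hsl1 := ae_integrable_slice_of_memLp hsl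
  -- entry data
  have hE : ∀ i j, Integrable (fun z => w i z * ∫ ξ, novackKernelE₀ ℓ i j ξ * u z.1 (z.2 + FunctionSpaces.Torus.proj ξ) j) μT ∧
      (∀ᶠ γ in 𝓝[>] (0 : ℝ), Integrable (fun z => w i z *
        ∫ ξ, novackKernelE ℓ γ i j ξ * u z.1 (z.2 + FunctionSpaces.Torus.proj ξ) j) μT) ∧
      Tendsto (fun γ => ∫ z, w i z * (∫ ξ, novackKernelE ℓ γ i j ξ * u z.1 (z.2 + FunctionSpaces.Torus.proj ξ) j) ∂μT)
        (𝓝[>] 0) (𝓝 (∫ z, w i z * (∫ ξ, novackKernelE₀ ℓ i j ξ * u z.1 (z.2 + FunctionSpaces.Torus.proj ξ) j) ∂μT)) :=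
    fun i j => tendsto_entryAverage_of_conj (T := T) hℓ i j (f := fun t x => u t x j)
      (aestronglyMeasurable_uncurry_apply hum j) (hsl1.mono fun t ht => ht.eval_piLp j)
      holderConjugate_threeHalves_three (lintegral_apply_rpow_three_lt_top hU3 j) (hw i) (hwa i)
  -- the sum of the entry pairings
  have hsum : Tendsto (fun γ => ∑ i, ∑ j, ∫ z, w i z *
        (∫ ξ, novackKernelE ℓ γ i j ξ * u z.1 (z.2 + FunctionSpaces.Torus.proj ξ) j) ∂μT) (𝓝[>] 0)
      (𝓝 (∑ i, ∑ j, ∫ z, w i z * (∫ ξ, novackKernelE₀ ℓ i j ξ * u z.1 (z.2 + FunctionSpaces.Torus.proj ξ) j) ∂μT)) :=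
    tendsto_finsetSum _ fun i _ => tendsto_finsetSum _ fun j _ => (hE i j).2.2
  -- identification for `γ > 0`
  have hγid : ∀ᶠ γ in 𝓝[>] (0 : ℝ), ∫ t in Ioo 0 T, ∫ x, ∑ i, w i (t, x) * matConv (u t) (novackKernel ℓ γ) x i =
      ∑ i, ∑ j, ∫ z, w i z * (∫ ξ, novackKernelE ℓ γ i j ξ * u z.1 (z.2 + FunctionSpaces.Torus.proj ξ) j) ∂μT := by
    have hall : ∀ᶠ γ in 𝓝[>] (0 : ℝ), ∀ i j, Integrable (fun z => w i z *
        ∫ ξ, novackKernelE ℓ γ i j ξ * u z.1 (z.2 + FunctionSpaces.Torus.proj ξ) j) μT :=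
      eventually_all.2 fun i => eventually_all.2 fun j => (hE i j).2.1
    filter_upwards [hall, self_mem_nhdsWithin] with γ hI hγ
    have hae := ae_matConv_novackKernel_apply (T := T) hℓ hγ hsl1
    have hptw : ∀ᵐ z ∂μT, ∑ i, w i z * matConv (u z.1) (novackKernel ℓ γ) z.2 i =
        ∑ i, ∑ j, w i z * ∫ ξ, novackKernelE ℓ γ i j ξ * u z.1 (z.2 + FunctionSpaces.Torus.proj ξ) j :=
      hae.mono fun z hz => Finset.sum_congr rfl fun i _ => by rw [hz i, Finset.mul_sum]
    have hint : Integrable (fun z => ∑ i, w i z * matConv (u z.1) (novackKernel ℓ γ) z.2 i) μT :=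
      (integrable_finsetSum _ fun i _ => integrable_finsetSum _ fun j _ => hI i j).congr
        (hptw.mono fun z hz => hz.symm)
    rw [← integral_prod _ hint, integral_congr_ae hptw,
      integral_finsetSum _ fun i _ => integrable_finsetSum _ fun j _ => hI i j]
    exact Finset.sum_congr rfl fun i _ => integral_finsetSum _ fun j _ => hI i j
  -- identification of the limit
  have hlim : ∫ t in Ioo 0 T, ∫ x, ∑ i, w i (t, x) * longAvg (u t) ℓ x i =
      ∑ i, ∑ j, ∫ z, w i z * (∫ ξ, novackKernelE₀ ℓ i j ξ * u z.1 (z.2 + FunctionSpaces.Torus.proj ξ) j) ∂μT := by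
    have hae : ∀ᵐ z ∂μT, ∀ i, longAvg (u z.1) ℓ z.2 i =
        ∑ j, ∫ ξ, novackKernelE₀ ℓ i j ξ * u z.1 (z.2 + FunctionSpaces.Torus.proj ξ) j := by
      filter_upwards [(quasiMeasurePreserving_fst (μ := volume.restrict (Ioo 0 T))
        (ν := (volume : Measure (UnitAddTorus d)))).ae hsl1] with z hz i
      exact longAvg_apply_eq_sum_integral hℓ hz z.2 i
    have hptw : ∀ᵐ z ∂μT, ∑ i, w i z * longAvg (u z.1) ℓ z.2 i =
        ∑ i, ∑ j, w i z * ∫ ξ, novackKernelE₀ ℓ i j ξ * u z.1 (z.2 + FunctionSpaces.Torus.proj ξ) j :=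
      hae.mono fun z hz => Finset.sum_congr rfl fun i _ => by rw [hz i, Finset.mul_sum]
    have hint : Integrable (fun z => ∑ i, w i z * longAvg (u z.1) ℓ z.2 i) μT :=
      (integrable_finsetSum _ fun i _ => integrable_finsetSum _ fun j _ => (hE i j).1).congr
        (hptw.mono fun z hz => hz.symm)
    rw [← integral_prod _ hint, integral_congr_ae hptw,
      integral_finsetSum _ fun i _ => integrable_finsetSum _ fun j _ => (hE i j).1]
    exact Finset.sum_congr rfl fun i _ => integral_finsetSum _ fun j _ => (hE i j).1
  rw [hlim]
  exact hsum.congr' (hγid.mono fun γ hγ => hγ.symm)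

omit [Fintype d] [DecidableEq d] in
/-- `‖|v|²‖ₑ = ‖v‖ₑ²`. [folklore] -/
theorem enorm_norm_sq' {E : Type*} [NormedAddCommGroup E] (v : E) : ‖‖v‖ ^ 2‖ₑ = ‖v‖ₑ ^ 2 := by
  rw [Real.enorm_eq_ofReal (sq_nonneg _), ENNReal.ofReal_pow (norm_nonneg _), ofReal_norm]

omit [DecidableEq d] in
/-- Products of two components of an `L³` field are in `L^{3/2}`. [folklore] -/
theorem lintegral_apply_mul_apply_rpow_threeHalves_lt_top
    (hU3 : ∫⁻ z, ‖u z.1 z.2‖ₑ ^ (3 : ℝ) ∂((volume.restrict (Ioo 0 T)).prod (volume : Measure (UnitAddTorus d))) < ⊤)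
    (i j : d) :
    ∫⁻ z, ‖uncurry (fun t x => u t x i * u t x j) z‖ₑ ^ (3 / 2 : ℝ)
      ∂((volume.restrict (Ioo 0 T)).prod (volume : Measure (UnitAddTorus d))) < ⊤ := by
  have hb : ∀ᵐ z ∂((volume.restrict (Ioo 0 T)).prod (volume : Measure (UnitAddTorus d))),
      ‖uncurry (fun t x => u t x i * u t x j) z‖ ≤ 1 * ‖‖u z.1 z.2‖ ^ 2‖ := ae_of_all _ fun z => by
    rw [one_mul, Real.norm_of_nonneg (sq_nonneg ‖u z.1 z.2‖)]
    show ‖u z.1 z.2 i * u z.1 z.2 j‖ ≤ ‖u z.1 z.2‖ ^ 2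
    rw [norm_mul, sq]
    exact mul_le_mul (PiLp.norm_apply_le _ _) (PiLp.norm_apply_le _ _) (norm_nonneg _) (norm_nonneg _)
  refine lintegral_rpow_lt_top_of_norm_le zero_le_one hb (by norm_num) ?_
  have e : ∀ z : ℝ × UnitAddTorus d, ‖‖u z.1 z.2‖ ^ 2‖ₑ ^ (3 / 2 : ℝ) = ‖u z.1 z.2‖ₑ ^ (3 : ℝ) := fun z => by
    rw [enorm_norm_sq', ← ENNReal.rpow_two, ← ENNReal.rpow_mul]
    norm_num
  simp_rw [e]
  exact hU3

/-- **Type II pairings converge** (term `D` of the balance: a weight `g ∈ L³` against the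
quadratic matrix average): as `γ → 0⁺`, `∫₀ᵀ∫ g (|u_{M_{ℓ,γ}}|²) → ∫₀ᵀ∫ g (|u_L|²)_ℓ`. [cite: Novack2024, Sect. 2 Step 2, limit γ → 0 (dominated convergence)] -/
theorem tendsto_integral_mul_matConvSq [Nonempty d] (hℓ : 0 < ℓ)
    (hum : AEStronglyMeasurable (uncurry u) ((volume.restrict (Ioo 0 T)).prod volume))
    (hU3 : ∫⁻ z, ‖u z.1 z.2‖ₑ ^ (3 : ℝ) ∂((volume.restrict (Ioo 0 T)).prod (volume : Measure (UnitAddTorus d))) < ⊤)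
    (hsl : ∀ᵐ t ∂(volume.restrict (Ioo 0 T)), MemLp (u t) 3 (volume : Measure (UnitAddTorus d)))
    {g : ℝ × UnitAddTorus d → ℝ} (hg : AEStronglyMeasurable g ((volume.restrict (Ioo 0 T)).prod volume))
    (hg3 : ∫⁻ z, ‖g z‖ₑ ^ (3 : ℝ) ∂((volume.restrict (Ioo 0 T)).prod (volume : Measure (UnitAddTorus d))) < ⊤) :
    Tendsto (fun γ => ∫ t in Ioo 0 T, ∫ x, g (t, x) * matConvSq (u t) (novackKernel ℓ γ) x)
      (𝓝[>] 0) (𝓝 (∫ t in Ioo 0 T, ∫ x, g (t, x) * longAvgSq (u t) ℓ x)) := by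
  set μT := (volume.restrict (Ioo 0 T)).prod (volume : Measure (UnitAddTorus d)) with hμT
  have hsl1 := ae_integrable_slice_of_memLp hsl
  have hsl2 : ∀ᵐ t ∂(volume.restrict (Ioo 0 T)), ∀ i j, Integrable (fun y => u t y i * u t y j) volume :=
    hsl.mono fun t ht i j => integrable_apply_mul_apply ht.1 (MemLp.integrable_norm_pow_three_and_sq ht).2.1 i j
  have hE : ∀ i j, Integrable (fun z => g z * ∫ ξ, novackKernelE₀ ℓ i j ξ *
        (u z.1 (z.2 + FunctionSpaces.Torus.proj ξ) i * u z.1 (z.2 + FunctionSpaces.Torus.proj ξ) j)) μT ∧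
      (∀ᶠ γ in 𝓝[>] (0 : ℝ), Integrable (fun z => g z * ∫ ξ, novackKernelE ℓ γ i j ξ *
        (u z.1 (z.2 + FunctionSpaces.Torus.proj ξ) i * u z.1 (z.2 + FunctionSpaces.Torus.proj ξ) j)) μT) ∧
      Tendsto (fun γ => ∫ z, g z * (∫ ξ, novackKernelE ℓ γ i j ξ *
        (u z.1 (z.2 + FunctionSpaces.Torus.proj ξ) i * u z.1 (z.2 + FunctionSpaces.Torus.proj ξ) j)) ∂μT)
        (𝓝[>] 0) (𝓝 (∫ z, g z * (∫ ξ, novackKernelE₀ ℓ i j ξ *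
        (u z.1 (z.2 + FunctionSpaces.Torus.proj ξ) i * u z.1 (z.2 + FunctionSpaces.Torus.proj ξ) j)) ∂μT)) :=
    fun i j => tendsto_entryAverage_of_conj (T := T) hℓ i j (f := fun t x => u t x i * u t x j)
      ((aestronglyMeasurable_uncurry_apply hum i).mul (aestronglyMeasurable_uncurry_apply hum j))
      (hsl2.mono fun t ht => ht i j) holderConjugate_threeHalves_three.symm
      (lintegral_apply_mul_apply_rpow_threeHalves_lt_top hU3 i j) hg hg3
  have hsum : Tendsto (fun γ => ∑ i, ∑ j, ∫ z, g z * (∫ ξ, novackKernelE ℓ γ i j ξ *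
        (u z.1 (z.2 + FunctionSpaces.Torus.proj ξ) i * u z.1 (z.2 + FunctionSpaces.Torus.proj ξ) j)) ∂μT) (𝓝[>] 0)
      (𝓝 (∑ i, ∑ j, ∫ z, g z * (∫ ξ, novackKernelE₀ ℓ i j ξ *
        (u z.1 (z.2 + FunctionSpaces.Torus.proj ξ) i * u z.1 (z.2 + FunctionSpaces.Torus.proj ξ) j)) ∂μT)) :=
    tendsto_finsetSum _ fun i _ => tendsto_finsetSum _ fun j _ => (hE i j).2.2
  have hγid : ∀ᶠ γ in 𝓝[>] (0 : ℝ), ∫ t in Ioo 0 T, ∫ x, g (t, x) * matConvSq (u t) (novackKernel ℓ γ) x =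
      ∑ i, ∑ j, ∫ z, g z * (∫ ξ, novackKernelE ℓ γ i j ξ *
        (u z.1 (z.2 + FunctionSpaces.Torus.proj ξ) i * u z.1 (z.2 + FunctionSpaces.Torus.proj ξ) j)) ∂μT := by
    have hall : ∀ᶠ γ in 𝓝[>] (0 : ℝ), ∀ i j, Integrable (fun z => g z * ∫ ξ, novackKernelE ℓ γ i j ξ *
        (u z.1 (z.2 + FunctionSpaces.Torus.proj ξ) i * u z.1 (z.2 + FunctionSpaces.Torus.proj ξ) j)) μT :=
      eventually_all.2 fun i => eventually_all.2 fun j => (hE i j).2.1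
    filter_upwards [hall, self_mem_nhdsWithin] with γ hI hγ
    have hptw : ∀ᵐ z ∂μT, g z * matConvSq (u z.1) (novackKernel ℓ γ) z.2 =
        ∑ i, ∑ j, g z * ∫ ξ, novackKernelE ℓ γ i j ξ *
          (u z.1 (z.2 + FunctionSpaces.Torus.proj ξ) i * u z.1 (z.2 + FunctionSpaces.Torus.proj ξ) j) :=
      (ae_matConvSq_novackKernel (T := T) hℓ hγ hsl).mono fun z hz => by
        rw [hz, Finset.mul_sum]
        exact Finset.sum_congr rfl fun i _ => Finset.mul_sum _ _ _
    have hint : Integrable (fun z => g z * matConvSq (u z.1) (novackKernel ℓ γ) z.2) μT :=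
      (integrable_finsetSum _ fun i _ => integrable_finsetSum _ fun j _ => hI i j).congr
        (hptw.mono fun z hz => hz.symm)
    rw [← integral_prod _ hint, integral_congr_ae hptw,
      integral_finsetSum _ fun i _ => integrable_finsetSum _ fun j _ => hI i j]
    exact Finset.sum_congr rfl fun i _ => integral_finsetSum _ fun j _ => hI i j
  have hlim : ∫ t in Ioo 0 T, ∫ x, g (t, x) * longAvgSq (u t) ℓ x =
      ∑ i, ∑ j, ∫ z, g z * (∫ ξ, novackKernelE₀ ℓ i j ξ *
        (u z.1 (z.2 + FunctionSpaces.Torus.proj ξ) i * u z.1 (z.2 + FunctionSpaces.Torus.proj ξ) j)) ∂μT := by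
    have hae : ∀ᵐ z ∂μT, longAvgSq (u z.1) ℓ z.2 = ∑ i, ∑ j, ∫ ξ, novackKernelE₀ ℓ i j ξ *
        (u z.1 (z.2 + FunctionSpaces.Torus.proj ξ) i * u z.1 (z.2 + FunctionSpaces.Torus.proj ξ) j) := by
      filter_upwards [(quasiMeasurePreserving_fst (μ := volume.restrict (Ioo 0 T))
        (ν := (volume : Measure (UnitAddTorus d)))).ae hsl] with z hz
      exact longAvgSq_eq_sum_integral hℓ (MemLp.integrable_norm_pow_three_and_sq hz).2.2
        (MemLp.integrable_norm_pow_three_and_sq hz).2.1 z.2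
    have hptw : ∀ᵐ z ∂μT, g z * longAvgSq (u z.1) ℓ z.2 =
        ∑ i, ∑ j, g z * ∫ ξ, novackKernelE₀ ℓ i j ξ *
          (u z.1 (z.2 + FunctionSpaces.Torus.proj ξ) i * u z.1 (z.2 + FunctionSpaces.Torus.proj ξ) j) :=
      hae.mono fun z hz => by
        rw [hz, Finset.mul_sum]
        exact Finset.sum_congr rfl fun i _ => Finset.mul_sum _ _ _
    have hint : Integrable (fun z => g z * longAvgSq (u z.1) ℓ z.2) μT :=
      (integrable_finsetSum _ fun i _ => integrable_finsetSum _ fun j _ => (hE i j).1).congr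
        (hptw.mono fun z hz => hz.symm)
    rw [← integral_prod _ hint, integral_congr_ae hptw,
      integral_finsetSum _ fun i _ => integrable_finsetSum _ fun j _ => (hE i j).1]
    exact Finset.sum_congr rfl fun i _ => integral_finsetSum _ fun j _ => (hE i j).1
  rw [hlim]
  exact hsum.congr' (hγid.mono fun γ hγ => hγ.symm)

/-- **Type IIp pairings converge** (term `F` of the balance: a weight `g ∈ L³` against the
potential-mollified pressure `p ⋆ ζ̃_{ℓ,γ}`): as `γ → 0⁺`,
`∫₀ᵀ∫ (p ⋆ ζ̃_{ℓ,γ}) g → ∫₀ᵀ∫ p_{L,ℓ} g`. [cite: Novack2024, Sect. 2 Step 2, limit γ → 0 (dominated convergence)] -/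
theorem tendsto_integral_convolution_potential_mul [Nonempty d] (hℓ : 0 < ℓ)
    (hpm : AEStronglyMeasurable (uncurry p) ((volume.restrict (Ioo 0 T)).prod volume))
    (hP32 : ∫⁻ z, ‖p z.1 z.2‖ₑ ^ (3 / 2 : ℝ) ∂((volume.restrict (Ioo 0 T)).prod (volume : Measure (UnitAddTorus d))) < ⊤)
    (hslp : ∀ᵐ t ∂(volume.restrict (Ioo 0 T)), Integrable (p t) (volume : Measure (UnitAddTorus d)))
    {g : ℝ × UnitAddTorus d → ℝ} (hg : AEStronglyMeasurable g ((volume.restrict (Ioo 0 T)).prod volume))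
    (hg3 : ∫⁻ z, ‖g z‖ₑ ^ (3 : ℝ) ∂((volume.restrict (Ioo 0 T)).prod (volume : Measure (UnitAddTorus d))) < ⊤) :
    Tendsto (fun γ => ∫ t in Ioo 0 T, ∫ x, (p t ⋆ novackPotential d ℓ γ) x * g (t, x))
      (𝓝[>] 0) (𝓝 (∫ t in Ioo 0 T, ∫ x, longAvgPressure d (p t) ℓ x * g (t, x))) := by
  set μT := (volume.restrict (Ioo 0 T)).prod (volume : Measure (UnitAddTorus d)) with hμT
  obtain ⟨hI₀, hI, hT⟩ := tendsto_potentialAverage_of_conj (T := T) hℓ (f := p) hpm hslp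
    holderConjugate_threeHalves_three.symm hP32 hg hg3
  have hγid : ∀ᶠ γ in 𝓝[>] (0 : ℝ), ∫ t in Ioo 0 T, ∫ x, (p t ⋆ novackPotential d ℓ γ) x * g (t, x) =
      ∫ z, g z * (∫ ξ, novackPotentialE d ℓ γ ξ * p z.1 (z.2 + FunctionSpaces.Torus.proj ξ)) ∂μT := by
    filter_upwards [hI, self_mem_nhdsWithin] with γ hIγ hγ
    have hptw : ∀ᵐ z ∂μT, (p z.1 ⋆ novackPotential d ℓ γ) z.2 * g z =
        g z * ∫ ξ, novackPotentialE d ℓ γ ξ * p z.1 (z.2 + FunctionSpaces.Torus.proj ξ) :=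
      (ae_convolution_novackPotential (T := T) hℓ hγ hslp).mono fun z hz => by rw [hz, mul_comm]
    have hint : Integrable (fun z => (p z.1 ⋆ novackPotential d ℓ γ) z.2 * g z) μT :=
      hIγ.congr (hptw.mono fun z hz => hz.symm)
    rw [← integral_prod _ hint, integral_congr_ae hptw]
  have hlim : ∫ t in Ioo 0 T, ∫ x, longAvgPressure d (p t) ℓ x * g (t, x) =
      ∫ z, g z * (∫ ξ, novackPotentialE₀ d ℓ ξ * p z.1 (z.2 + FunctionSpaces.Torus.proj ξ)) ∂μT := by
    have hptw : ∀ᵐ z ∂μT, longAvgPressure d (p z.1) ℓ z.2 * g z =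
        g z * ∫ ξ, novackPotentialE₀ d ℓ ξ * p z.1 (z.2 + FunctionSpaces.Torus.proj ξ) :=
      ae_of_all _ fun z => by rw [longAvgPressure_eq_integral hℓ z.2, mul_comm]
    have hint : Integrable (fun z => longAvgPressure d (p z.1) ℓ z.2 * g z) μT :=
      hI₀.congr (hptw.mono fun z hz => hz.symm)
    rw [← integral_prod _ hint, integral_congr_ae hptw]
  rw [hlim]
  exact hT.congr' (hγid.mono fun γ hγ => hγ.symm)

/-- **Type III pairings converge** (term `C` of the balance: bounded weights `wₖ = ∂ₖψ` against
the cubic matrix average): as `γ → 0⁺`, `∫₀ᵀ∫ ∑ₖ wₖ (u_k|u_{M}|²)_{ℓ,γ} → ∫₀ᵀ∫ ∑ₖ wₖ (uᵏ|u_L|²)_ℓ`. [cite: Novack2024, Sect. 2 Step 2, limit γ → 0 (dominated convergence)] -/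
theorem tendsto_integral_sum_mul_matConvCube [Nonempty d] (hℓ : 0 < ℓ)
    (hum : AEStronglyMeasurable (uncurry u) ((volume.restrict (Ioo 0 T)).prod volume))
    (hU3 : ∫⁻ z, ‖u z.1 z.2‖ₑ ^ (3 : ℝ) ∂((volume.restrict (Ioo 0 T)).prod (volume : Measure (UnitAddTorus d))) < ⊤)
    (hsl : ∀ᵐ t ∂(volume.restrict (Ioo 0 T)), MemLp (u t) 3 (volume : Measure (UnitAddTorus d)))
    {w : d → ℝ × UnitAddTorus d → ℝ} (hw : ∀ k, AEStronglyMeasurable (w k) ((volume.restrict (Ioo 0 T)).prod volume))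
    {Cw : ℝ} (hwb : ∀ k z, ‖w k z‖ ≤ Cw) :
    Tendsto (fun γ => ∫ t in Ioo 0 T, ∫ x, ∑ k, w k (t, x) * matConvCube (u t) (novackKernel ℓ γ) x k)
      (𝓝[>] 0) (𝓝 (∫ t in Ioo 0 T, ∫ x, ∑ k, w k (t, x) * longAvgCube (u t) ℓ x k)) := by
  set μT := (volume.restrict (Ioo 0 T)).prod (volume : Measure (UnitAddTorus d)) with hμT
  have hsl1 := ae_integrable_slice_of_memLp hsl
  have hvmeas : ∀ j, AEStronglyMeasurable (uncurry fun t x => u t x j) μT := fun j =>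
    aestronglyMeasurable_uncurry_apply hum j
  -- slices of `uᵢuⱼuₖ` are integrable, and the field is in `L¹`
  have hsl3 : ∀ᵐ t ∂(volume.restrict (Ioo 0 T)), ∀ i j k, Integrable (fun y => u t y i * u t y j * u t y k) volume := by
    filter_upwards [hsl] with t ht i j k
    obtain ⟨I3, -, -⟩ := MemLp.integrable_norm_pow_three_and_sq ht
    have hm : ∀ j, AEStronglyMeasurable (fun y => u t y j) volume := fun j =>
      (EuclideanSpace.proj (𝕜 := ℝ) j).continuous.comp_aestronglyMeasurable ht.1
    refine I3.mono' (((hm i).mul (hm j)).mul (hm k)) (ae_of_all _ fun y => ?_)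
    rw [norm_mul, norm_mul]
    calc ‖u t y i‖ * ‖u t y j‖ * ‖u t y k‖ ≤ ‖u t y‖ * ‖u t y‖ * ‖u t y‖ := by
          gcongr <;> exact PiLp.norm_apply_le _ _
      _ = ‖u t y‖ ^ 3 := by ring
  have hf1 : ∀ i j k, ∫⁻ z, ‖uncurry (fun t x => u t x i * u t x j * u t x k) z‖ₑ ∂μT < ⊤ := by
    intro i j k
    have hb : ∀ᵐ z ∂μT, ‖uncurry (fun t x => u t x i * u t x j * u t x k) z‖ ≤ 1 * ‖‖u z.1 z.2‖ ^ 3‖ :=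
      ae_of_all _ fun z => by
      rw [one_mul, Real.norm_of_nonneg (pow_nonneg (norm_nonneg (u z.1 z.2)) 3)]
      show ‖u z.1 z.2 i * u z.1 z.2 j * u z.1 z.2 k‖ ≤ ‖u z.1 z.2‖ ^ 3
      rw [norm_mul, norm_mul]
      calc ‖u z.1 z.2 i‖ * ‖u z.1 z.2 j‖ * ‖u z.1 z.2 k‖ ≤ ‖u z.1 z.2‖ * ‖u z.1 z.2‖ * ‖u z.1 z.2‖ := by
            gcongr <;> exact PiLp.norm_apply_le _ _
        _ = ‖u z.1 z.2‖ ^ 3 := by ring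
    have h := lintegral_rpow_lt_top_of_norm_le zero_le_one hb zero_le_one (r := 1) ?_
    · simpa only [ENNReal.rpow_one] using h
    · have e : ∀ z : ℝ × UnitAddTorus d, ‖‖u z.1 z.2‖ ^ 3‖ₑ ^ (1 : ℝ) = ‖u z.1 z.2‖ₑ ^ (3 : ℝ) := fun z => by
        rw [ENNReal.rpow_one, Real.enorm_eq_ofReal (pow_nonneg (norm_nonneg _) 3),
          ENNReal.ofReal_pow (norm_nonneg _), ofReal_norm, ← ENNReal.rpow_natCast]
        norm_num
      simp_rw [e]
      exact hU3
  have hE : ∀ i j k, Integrable (fun z => w k z * ∫ ξ, novackKernelE₀ ℓ i j ξ *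
        (u z.1 (z.2 + FunctionSpaces.Torus.proj ξ) i * u z.1 (z.2 + FunctionSpaces.Torus.proj ξ) j *
          u z.1 (z.2 + FunctionSpaces.Torus.proj ξ) k)) μT ∧
      (∀ᶠ γ in 𝓝[>] (0 : ℝ), Integrable (fun z => w k z * ∫ ξ, novackKernelE ℓ γ i j ξ *
        (u z.1 (z.2 + FunctionSpaces.Torus.proj ξ) i * u z.1 (z.2 + FunctionSpaces.Torus.proj ξ) j *
          u z.1 (z.2 + FunctionSpaces.Torus.proj ξ) k)) μT) ∧
      Tendsto (fun γ => ∫ z, w k z * (∫ ξ, novackKernelE ℓ γ i j ξ *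
        (u z.1 (z.2 + FunctionSpaces.Torus.proj ξ) i * u z.1 (z.2 + FunctionSpaces.Torus.proj ξ) j *
          u z.1 (z.2 + FunctionSpaces.Torus.proj ξ) k)) ∂μT)
        (𝓝[>] 0) (𝓝 (∫ z, w k z * (∫ ξ, novackKernelE₀ ℓ i j ξ *
        (u z.1 (z.2 + FunctionSpaces.Torus.proj ξ) i * u z.1 (z.2 + FunctionSpaces.Torus.proj ξ) j *
          u z.1 (z.2 + FunctionSpaces.Torus.proj ξ) k)) ∂μT)) :=
    fun i j k => tendsto_entryAverage_of_bound (T := T) hℓ i j (f := fun t x => u t x i * u t x j * u t x k)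
      (((hvmeas i).mul (hvmeas j)).mul (hvmeas k)) (hsl3.mono fun t ht => ht i j k) (hf1 i j k) (hw k) (hwb k)
  have hsum : Tendsto (fun γ => ∑ k, ∑ i, ∑ j, ∫ z, w k z * (∫ ξ, novackKernelE ℓ γ i j ξ *
        (u z.1 (z.2 + FunctionSpaces.Torus.proj ξ) i * u z.1 (z.2 + FunctionSpaces.Torus.proj ξ) j *
          u z.1 (z.2 + FunctionSpaces.Torus.proj ξ) k)) ∂μT) (𝓝[>] 0)
      (𝓝 (∑ k, ∑ i, ∑ j, ∫ z, w k z * (∫ ξ, novackKernelE₀ ℓ i j ξ *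
        (u z.1 (z.2 + FunctionSpaces.Torus.proj ξ) i * u z.1 (z.2 + FunctionSpaces.Torus.proj ξ) j *
          u z.1 (z.2 + FunctionSpaces.Torus.proj ξ) k)) ∂μT)) :=
    tendsto_finsetSum _ fun k _ => tendsto_finsetSum _ fun i _ => tendsto_finsetSum _ fun j _ => (hE i j k).2.2
  have hγid : ∀ᶠ γ in 𝓝[>] (0 : ℝ), ∫ t in Ioo 0 T, ∫ x, ∑ k, w k (t, x) * matConvCube (u t) (novackKernel ℓ γ) x k =
      ∑ k, ∑ i, ∑ j, ∫ z, w k z * (∫ ξ, novackKernelE ℓ γ i j ξ *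
        (u z.1 (z.2 + FunctionSpaces.Torus.proj ξ) i * u z.1 (z.2 + FunctionSpaces.Torus.proj ξ) j *
          u z.1 (z.2 + FunctionSpaces.Torus.proj ξ) k)) ∂μT := by
    have hall : ∀ᶠ γ in 𝓝[>] (0 : ℝ), ∀ i j k, Integrable (fun z => w k z * ∫ ξ, novackKernelE ℓ γ i j ξ *
        (u z.1 (z.2 + FunctionSpaces.Torus.proj ξ) i * u z.1 (z.2 + FunctionSpaces.Torus.proj ξ) j *
          u z.1 (z.2 + FunctionSpaces.Torus.proj ξ) k)) μT :=
      eventually_all.2 fun i => eventually_all.2 fun j => eventually_all.2 fun k => (hE i j k).2.1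
    filter_upwards [hall, self_mem_nhdsWithin] with γ hI hγ
    have hptw : ∀ᵐ z ∂μT, ∑ k, w k z * matConvCube (u z.1) (novackKernel ℓ γ) z.2 k =
        ∑ k, ∑ i, ∑ j, w k z * ∫ ξ, novackKernelE ℓ γ i j ξ *
          (u z.1 (z.2 + FunctionSpaces.Torus.proj ξ) i * u z.1 (z.2 + FunctionSpaces.Torus.proj ξ) j *
            u z.1 (z.2 + FunctionSpaces.Torus.proj ξ) k) :=
      (ae_matConvCube_novackKernel_apply (T := T) hℓ hγ hsl).mono fun z hz =>
        Finset.sum_congr rfl fun k _ => by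
          rw [hz k, Finset.mul_sum]
          exact Finset.sum_congr rfl fun i _ => Finset.mul_sum _ _ _
    have hint : Integrable (fun z => ∑ k, w k z * matConvCube (u z.1) (novackKernel ℓ γ) z.2 k) μT :=
      (integrable_finsetSum _ fun k _ => integrable_finsetSum _ fun i _ =>
        integrable_finsetSum _ fun j _ => hI i j k).congr (hptw.mono fun z hz => hz.symm)
    rw [← integral_prod _ hint, integral_congr_ae hptw,
      integral_finsetSum _ fun k _ => integrable_finsetSum _ fun i _ => integrable_finsetSum _ fun j _ => hI i j k]
    refine Finset.sum_congr rfl fun k _ => ?_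
    rw [integral_finsetSum _ fun i _ => integrable_finsetSum _ fun j _ => hI i j k]
    exact Finset.sum_congr rfl fun i _ => integral_finsetSum _ fun j _ => hI i j k
  have hlim : ∫ t in Ioo 0 T, ∫ x, ∑ k, w k (t, x) * longAvgCube (u t) ℓ x k =
      ∑ k, ∑ i, ∑ j, ∫ z, w k z * (∫ ξ, novackKernelE₀ ℓ i j ξ *
        (u z.1 (z.2 + FunctionSpaces.Torus.proj ξ) i * u z.1 (z.2 + FunctionSpaces.Torus.proj ξ) j *
          u z.1 (z.2 + FunctionSpaces.Torus.proj ξ) k)) ∂μT := by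
    have hae : ∀ᵐ z ∂μT, ∀ k, longAvgCube (u z.1) ℓ z.2 k = ∑ i, ∑ j, ∫ ξ, novackKernelE₀ ℓ i j ξ *
        (u z.1 (z.2 + FunctionSpaces.Torus.proj ξ) i * u z.1 (z.2 + FunctionSpaces.Torus.proj ξ) j *
          u z.1 (z.2 + FunctionSpaces.Torus.proj ξ) k) := by
      filter_upwards [(quasiMeasurePreserving_fst (μ := volume.restrict (Ioo 0 T))
        (ν := (volume : Measure (UnitAddTorus d)))).ae hsl] with z hz k
      exact longAvgCube_apply_eq_sum_integral hℓ (MemLp.integrable_norm_pow_three_and_sq hz).2.2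
        (MemLp.integrable_norm_pow_three_and_sq hz).1 z.2 k
    have hptw : ∀ᵐ z ∂μT, ∑ k, w k z * longAvgCube (u z.1) ℓ z.2 k =
        ∑ k, ∑ i, ∑ j, w k z * ∫ ξ, novackKernelE₀ ℓ i j ξ *
          (u z.1 (z.2 + FunctionSpaces.Torus.proj ξ) i * u z.1 (z.2 + FunctionSpaces.Torus.proj ξ) j *
            u z.1 (z.2 + FunctionSpaces.Torus.proj ξ) k) :=
      hae.mono fun z hz => Finset.sum_congr rfl fun k _ => by
        rw [hz k, Finset.mul_sum]
        exact Finset.sum_congr rfl fun i _ => Finset.mul_sum _ _ _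
    have hint : Integrable (fun z => ∑ k, w k z * longAvgCube (u z.1) ℓ z.2 k) μT :=
      (integrable_finsetSum _ fun k _ => integrable_finsetSum _ fun i _ =>
        integrable_finsetSum _ fun j _ => (hE i j k).1).congr (hptw.mono fun z hz => hz.symm)
    rw [← integral_prod _ hint, integral_congr_ae hptw,
      integral_finsetSum _ fun k _ => integrable_finsetSum _ fun i _ => integrable_finsetSum _ fun j _ => (hE i j k).1]
    refine Finset.sum_congr rfl fun k _ => ?_
    rw [integral_finsetSum _ fun i _ => integrable_finsetSum _ fun j _ => (hE i j k).1]
    exact Finset.sum_congr rfl fun i _ => integral_finsetSum _ fun j _ => (hE i j k).1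
  rw [hlim]
  exact hsum.congr' (hγid.mono fun γ hγ => hγ.symm)

/-! ### The limit of the tested balance -/

/-- **Novack 2024, §2 Step 2: the limit `γ → 0` in the left-hand side of the combined
balance** — the content of the named fact `Torus.tendsto_matPairing_novackKernel`
(`NovackLongitudinalBalanceSteps`), **proved**: for a jointly measurable `u ∈ L³((0,T) × T^d)`,
`p ∈ L^{3/2}((0,T) × T^d)`, a scale `ℓ > 0` and a test function `ψ` supported in `(0,T)`,
`𝒩_{M_{ℓ,γ}}(ψ) → 𝒩^L_ℓ(ψ)` as `γ → 0⁺` (the six pairings of `Torus.matPairing` converge to those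
of `Torus.novackLongPairing`: types I (`A`, `B`, `E`), II (`D`), IIp (`F`), III (`C`)). [cite: Novack2024, Sect. 2 Step 2 (last:one:L:L), limit γ → 0] -/
theorem tendsto_matPairing_novackKernel_of_test [Nonempty d]
    (hmeas : AEStronglyMeasurable (FunctionSpaces.Torus.stLift u) (volume.restrict (Ioo 0 T ×ˢ univ)))
    (hu3 : ∫⁻ t in Ioo 0 T, ∫⁻ x, ‖u t x‖ₑ ^ 3 < ⊤)
    (hpmeas : AEStronglyMeasurable (FunctionSpaces.Torus.stLift p) (volume.restrict (Ioo 0 T ×ˢ univ)))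
    (hp : ∫⁻ t in Ioo 0 T, ∫⁻ x, ‖p t x‖ₑ ^ (3 / 2 : ℝ) < ⊤) (hℓ : 0 < ℓ)
    (hψ : FunctionSpaces.Torus.IsSpaceTimeTestIoo T ψ) :
    Tendsto (fun γ => matPairing T u p ψ (novackKernel ℓ γ) (novackPotential d ℓ γ)) (𝓝[>] 0)
      (𝓝 (novackLongPairing T u p ψ ℓ)) := by
  set μT := (volume.restrict (Ioo 0 T)).prod (volume : Measure (UnitAddTorus d)) with hμT
  -- measurability and finiteness in product form
  have hum : AEStronglyMeasurable (uncurry u) μT := aestronglyMeasurable_uncurry_prod hmeas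
  have hpm : AEStronglyMeasurable (uncurry p) μT := aestronglyMeasurable_uncurry_prod hpmeas
  have hU3 : ∫⁻ z, ‖u z.1 z.2‖ₑ ^ (3 : ℝ) ∂μT < ⊤ := by
    have e : ∫⁻ t in Ioo 0 T, ∫⁻ x, ‖u t x‖ₑ ^ (3 : ℝ) = ∫⁻ z, ‖u z.1 z.2‖ₑ ^ (3 : ℝ) ∂μT :=
      lintegral_Ioo_lintegral_eq_lintegral_prod (hum.enorm.pow_const _)
    rw [← e]
    simpa only [ENNReal.rpow_ofNat] using hu3
  have hP32 : ∫⁻ z, ‖p z.1 z.2‖ₑ ^ (3 / 2 : ℝ) ∂μT < ⊤ := by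
    have e : ∫⁻ t in Ioo 0 T, ∫⁻ x, ‖p t x‖ₑ ^ (3 / 2 : ℝ) = ∫⁻ z, ‖p z.1 z.2‖ₑ ^ (3 / 2 : ℝ) ∂μT :=
      lintegral_Ioo_lintegral_eq_lintegral_prod (hpm.enorm.pow_const _)
    rw [← e]
    exact hp
  have hU32 : ∫⁻ z, ‖u z.1 z.2‖ₑ ^ (3 / 2 : ℝ) ∂μT < ⊤ :=
    lintegral_rpow_threeHalves_lt_top_of_three hum.enorm hU3
  -- slices
  have hsl : ∀ᵐ t ∂(volume.restrict (Ioo 0 T)), MemLp (u t) 3 (volume : Measure (UnitAddTorus d)) := by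
    have h := FunctionSpaces.Torus.ae_memLp_of_lintegral_prod_rpow_lt_top hum (by norm_num : (0:ℝ) < 3) hU3
    have h3 : ENNReal.ofReal 3 = 3 := by norm_num
    rwa [h3] at h
  have hslp : ∀ᵐ t ∂(volume.restrict (Ioo 0 T)), Integrable (p t) (volume : Measure (UnitAddTorus d)) := by
    have h := FunctionSpaces.Torus.ae_memLp_of_lintegral_prod_rpow_lt_top hpm (by norm_num : (0:ℝ) < 3 / 2) hP32
    filter_upwards [h] with t ht
    exact ht.integrable (by rw [← ENNReal.ofReal_one]; exact ENNReal.ofReal_le_ofReal (by norm_num))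
  -- the test function: bounded measurable time derivative and gradient
  obtain ⟨-, hdt, hgr, -⟩ := hψ.isSpaceTimeTest.isSmoothSpaceTimeOn_derived
  obtain ⟨⟨Cd, hCd0, hCd⟩, hdtm⟩ := hdt.bound_and_measurable T
  obtain ⟨⟨C, hC0, hC⟩, hgrm⟩ := hgr.bound_and_measurable T
  have hIoo : ∀ᵐ z ∂μT, z.1 ∈ Ioo 0 T := by
    rw [hμT, ← volume_restrict_Ioo_prod_univ]
    filter_upwards [ae_restrict_mem (measurableSet_Ioo.prod MeasurableSet.univ)] with z hz
    exact hz.1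
  have hdtb : ∀ᵐ z ∂μT, ‖FunctionSpaces.Torus.timeDeriv ψ z.1 z.2‖ ≤ Cd :=
    hIoo.mono fun z hz => hCd z.1 (Ioo_subset_Icc_self hz) z.2
  have hgrb : ∀ᵐ z ∂μT, ‖FunctionSpaces.Torus.gradient (ψ z.1) z.2‖ ≤ C :=
    hIoo.mono fun z hz => hC z.1 (Ioo_subset_Icc_self hz) z.2
  -- the weights
  set g : ℝ × UnitAddTorus d → ℝ := fun z => ⟪u z.1 z.2, FunctionSpaces.Torus.gradient (ψ z.1) z.2⟫ with hg
  set wA : d → ℝ × UnitAddTorus d → ℝ := fun i z => u z.1 z.2 i * FunctionSpaces.Torus.timeDeriv ψ z.1 z.2 with hwA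
  set wB : d → ℝ × UnitAddTorus d → ℝ := fun i z => u z.1 z.2 i * g z with hwB
  set wC : d → ℝ × UnitAddTorus d → ℝ := fun k z => FunctionSpaces.Torus.gradient (ψ z.1) z.2 k with hwC
  set wE : d → ℝ × UnitAddTorus d → ℝ := fun i z => p z.1 z.2 * FunctionSpaces.Torus.gradient (ψ z.1) z.2 i with hwE
  have hui_m : ∀ i, AEStronglyMeasurable (fun z : ℝ × UnitAddTorus d => u z.1 z.2 i) μT := fun i =>
    aestronglyMeasurable_uncurry_apply hum i
  have hgri_m : ∀ i, AEStronglyMeasurable (fun z : ℝ × UnitAddTorus d => FunctionSpaces.Torus.gradient (ψ z.1) z.2 i) μT :=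
    fun i => aestronglyMeasurable_uncurry_apply hgrm i
  have hg_m : AEStronglyMeasurable g μT := hum.inner hgrm
  have hwA_m : ∀ i, AEStronglyMeasurable (wA i) μT := fun i => (hui_m i).mul hdtm
  have hwB_m : ∀ i, AEStronglyMeasurable (wB i) μT := fun i => (hui_m i).mul hg_m
  have hwC_m : ∀ k, AEStronglyMeasurable (wC k) μT := hgri_m
  have hwE_m : ∀ i, AEStronglyMeasurable (wE i) μT := fun i => hpm.mul (hgri_m i)
  have hg_3 : ∫⁻ z, ‖g z‖ₑ ^ (3 : ℝ) ∂μT < ⊤ := by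
    have hb : ∀ᵐ z ∂μT, ‖g z‖ ≤ C * ‖u z.1 z.2‖ := hgrb.mono fun z hz => by
      calc ‖⟪u z.1 z.2, FunctionSpaces.Torus.gradient (ψ z.1) z.2⟫‖
          ≤ ‖u z.1 z.2‖ * ‖FunctionSpaces.Torus.gradient (ψ z.1) z.2‖ := norm_inner_le_norm _ _
        _ ≤ ‖u z.1 z.2‖ * C := mul_le_mul_of_nonneg_left hz (norm_nonneg _)
        _ = C * ‖u z.1 z.2‖ := mul_comm _ _
    exact lintegral_rpow_lt_top_of_norm_le hC0 hb (by norm_num) hU3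
  have hwA_32 : ∀ i, ∫⁻ z, ‖wA i z‖ₑ ^ (3 / 2 : ℝ) ∂μT < ⊤ := by
    intro i
    have hb : ∀ᵐ z ∂μT, ‖wA i z‖ ≤ Cd * ‖u z.1 z.2‖ := hdtb.mono fun z hz => by
      rw [hwA, norm_mul]
      calc ‖u z.1 z.2 i‖ * ‖FunctionSpaces.Torus.timeDeriv ψ z.1 z.2‖ ≤ ‖u z.1 z.2‖ * Cd :=
            mul_le_mul (PiLp.norm_apply_le _ _) hz (norm_nonneg _) (norm_nonneg _)
        _ = Cd * ‖u z.1 z.2‖ := mul_comm _ _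
    exact lintegral_rpow_lt_top_of_norm_le hCd0 hb (by norm_num) hU32
  have hwB_32 : ∀ i, ∫⁻ z, ‖wB i z‖ₑ ^ (3 / 2 : ℝ) ∂μT < ⊤ := by
    intro i
    have hb : ∀ᵐ z ∂μT, ‖wB i z‖ ≤ C * ‖‖u z.1 z.2‖ ^ 2‖ := hgrb.mono fun z hz => by
      rw [hwB, norm_mul, Real.norm_of_nonneg (sq_nonneg ‖u z.1 z.2‖)]
      calc ‖u z.1 z.2 i‖ * ‖g z‖ ≤ ‖u z.1 z.2‖ * (‖u z.1 z.2‖ * C) := by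
            refine mul_le_mul (PiLp.norm_apply_le _ _) ?_ (norm_nonneg _) (norm_nonneg _)
            exact (norm_inner_le_norm _ _).trans (mul_le_mul_of_nonneg_left hz (norm_nonneg _))
        _ = C * ‖u z.1 z.2‖ ^ 2 := by ring
    refine lintegral_rpow_lt_top_of_norm_le hC0 hb (by norm_num) ?_
    have e : ∀ z : ℝ × UnitAddTorus d, ‖‖u z.1 z.2‖ ^ 2‖ₑ ^ (3 / 2 : ℝ) = ‖u z.1 z.2‖ₑ ^ (3 : ℝ) := fun z => by
      rw [enorm_norm_sq', ← ENNReal.rpow_two, ← ENNReal.rpow_mul]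
      norm_num
    simp_rw [e]
    exact hU3
  have hwE_32 : ∀ i, ∫⁻ z, ‖wE i z‖ₑ ^ (3 / 2 : ℝ) ∂μT < ⊤ := by
    intro i
    have hb : ∀ᵐ z ∂μT, ‖wE i z‖ ≤ C * ‖p z.1 z.2‖ := hgrb.mono fun z hz => by
      rw [hwE, norm_mul]
      calc ‖p z.1 z.2‖ * ‖FunctionSpaces.Torus.gradient (ψ z.1) z.2 i‖ ≤ ‖p z.1 z.2‖ * C :=
            mul_le_mul_of_nonneg_left ((PiLp.norm_apply_le _ i).trans hz) (norm_nonneg _)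
        _ = C * ‖p z.1 z.2‖ := mul_comm _ _
    exact lintegral_rpow_lt_top_of_norm_le hC0 hb (by norm_num) hP32
  have hwC_b : ∀ k z, ‖wC k z‖ ≤ max C (‖FunctionSpaces.Torus.gradient (ψ 0) 0‖ + 1) + |C| := by
    intro k z
    -- a crude everywhere bound: `|∂ₖψ(t,x)| ≤ C` on `[0,T]`, and the gradient of a test function
    -- vanishes off `(0,T)`; we only need some uniform constant, obtained from `hψ.exists_abs_le`-type
    -- reasoning on the smooth gradient. Use the global bound of the continuous compactly-time-supported field.
    exact le_trans (PiLp.norm_apply_le _ k) (by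
      rcases (em (z.1 ∈ Icc (0 : ℝ) T)) with hz | hz
      · exact (hC z.1 hz z.2).trans ((le_max_left _ _).trans (le_add_of_nonneg_right (abs_nonneg C)))
      · have h0 : ψ z.1 = 0 := by
          obtain ⟨⟨-, T', hT', hT⟩, ε, hε, h0⟩ := hψ
          simp only [mem_Icc, not_and_or, not_le] at hz
          rcases hz with hz | hz
          · exact h0 z.1 (hz.le.trans hε.le)
          · exact hT z.1 (hT'.le.trans hz.le)
        have : FunctionSpaces.Torus.gradient (ψ z.1) z.2 = 0 := by
          rw [h0]
          show _root_.gradient (fun v : EuclideanSpace ℝ d => (0 : UnitAddTorus d → ℝ) (z.2 + FunctionSpaces.Torus.proj v)) 0 = 0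
          exact gradient_fun_const _ _
        rw [this, norm_zero]
        positivity)
  -- the six limits
  have hA := tendsto_integral_sum_mul_matConv (T := T) hℓ hum hU3 hsl hwA_m hwA_32
  have hB := tendsto_integral_sum_mul_matConv (T := T) hℓ hum hU3 hsl hwB_m hwB_32
  have hCt := tendsto_integral_sum_mul_matConvCube (T := T) hℓ hum hU3 hsl hwC_m hwC_b
  have hD := tendsto_integral_mul_matConvSq (T := T) hℓ hum hU3 hsl hg_m hg_3
  have hE := tendsto_integral_sum_mul_matConv (T := T) hℓ hum hU3 hsl hwE_m hwE_32
  have hF := tendsto_integral_convolution_potential_mul (T := T) hℓ hpm hP32 hslp hg_m hg_3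
  -- pointwise identification of the integrands of `matPairing` / `novackLongPairing`
  have eI : ∀ (m : EuclideanSpace ℝ d) (t : ℝ) (x : UnitAddTorus d) (c : ℝ),
      ⟪u t x, m⟫ * c = ∑ i, (u t x i * c) * m i := fun m t x c => by
    rw [real_inner_eq_sum_mul, Finset.sum_mul]
    exact Finset.sum_congr rfl fun i _ => by ring
  have eE : ∀ (m : EuclideanSpace ℝ d) (t : ℝ) (x : UnitAddTorus d) (c : ℝ),
      c * ⟪m, FunctionSpaces.Torus.gradient (ψ t) x⟫ =
        ∑ i, (c * FunctionSpaces.Torus.gradient (ψ t) x i) * m i := fun m t x c => by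
    rw [real_inner_eq_sum_mul, Finset.mul_sum]
    exact Finset.sum_congr rfl fun i _ => by ring
  have eC : ∀ (m : EuclideanSpace ℝ d) (t : ℝ) (x : UnitAddTorus d),
      ⟪m, FunctionSpaces.Torus.gradient (ψ t) x⟫ = ∑ k, FunctionSpaces.Torus.gradient (ψ t) x k * m k :=
    fun m t x => by
    rw [real_inner_eq_sum_mul]
    exact Finset.sum_congr rfl fun k _ => mul_comm _ _
  simp only [matPairing, novackLongPairing]
  refine ((((((hA.congr' ?_).const_mul 2).add ((hB.congr' ?_).const_mul 2)).add (hCt.congr' ?_)).sub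
    (hD.congr' ?_)).add ((hE.congr' ?_).const_mul 2)).add ((hF.congr' ?_).const_mul 2) |>.trans ?_
  · exact Eventually.of_forall fun γ => integral_congr_ae (ae_of_all _ fun t =>
      integral_congr_ae (ae_of_all _ fun x => (eI _ t x _).symm))
  · exact Eventually.of_forall fun γ => integral_congr_ae (ae_of_all _ fun t =>
      integral_congr_ae (ae_of_all _ fun x => (eI _ t x _).symm))
  · exact Eventually.of_forall fun γ => integral_congr_ae (ae_of_all _ fun t =>
      integral_congr_ae (ae_of_all _ fun x => (eC _ t x).symm))
  · exact Eventually.of_forall fun γ => integral_congr_ae (ae_of_all _ fun t =>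
      integral_congr_ae (ae_of_all _ fun x => mul_comm _ _))
  · exact Eventually.of_forall fun γ => integral_congr_ae (ae_of_all _ fun t =>
      integral_congr_ae (ae_of_all _ fun x => (eE _ t x _).symm))
  · exact Eventually.of_forall fun γ => rfl
  · refine le_of_eq (congrArg 𝓝 ?_)
    have e1 : (∫ t in Ioo 0 T, ∫ x, ∑ i, wA i (t, x) * longAvg (u t) ℓ x i) =
        ∫ t in Ioo 0 T, ∫ x, ⟪u t x, longAvg (u t) ℓ x⟫ * FunctionSpaces.Torus.timeDeriv ψ t x :=
      integral_congr_ae (ae_of_all _ fun t => integral_congr_ae (ae_of_all _ fun x => (eI _ t x _).symm))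
    have e2 : (∫ t in Ioo 0 T, ∫ x, ∑ i, wB i (t, x) * longAvg (u t) ℓ x i) =
        ∫ t in Ioo 0 T, ∫ x, ⟪u t x, longAvg (u t) ℓ x⟫ * ⟪u t x, FunctionSpaces.Torus.gradient (ψ t) x⟫ :=
      integral_congr_ae (ae_of_all _ fun t => integral_congr_ae (ae_of_all _ fun x => (eI _ t x _).symm))
    have e3 : (∫ t in Ioo 0 T, ∫ x, ∑ k, wC k (t, x) * longAvgCube (u t) ℓ x k) =
        ∫ t in Ioo 0 T, ∫ x, ⟪longAvgCube (u t) ℓ x, FunctionSpaces.Torus.gradient (ψ t) x⟫ :=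
      integral_congr_ae (ae_of_all _ fun t => integral_congr_ae (ae_of_all _ fun x => (eC _ t x).symm))
    have e4 : (∫ t in Ioo 0 T, ∫ x, g (t, x) * longAvgSq (u t) ℓ x) =
        ∫ t in Ioo 0 T, ∫ x, longAvgSq (u t) ℓ x * ⟪u t x, FunctionSpaces.Torus.gradient (ψ t) x⟫ :=
      integral_congr_ae (ae_of_all _ fun t => integral_congr_ae (ae_of_all _ fun x => mul_comm _ _))
    have e5 : (∫ t in Ioo 0 T, ∫ x, ∑ i, wE i (t, x) * longAvg (u t) ℓ x i) =
        ∫ t in Ioo 0 T, ∫ x, p t x * ⟪longAvg (u t) ℓ x, FunctionSpaces.Torus.gradient (ψ t) x⟫ :=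
      integral_congr_ae (ae_of_all _ fun t => integral_congr_ae (ae_of_all _ fun x => (eE _ t x _).symm))
    rw [e1, e2, e3, e4, e5]

end Assembly

end Literature.Analysis.FluidPDE.Torus
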